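import Literature.NumberTheory.LFunctions.VinogradovKorobovZeroDetector
import Literature.NumberTheory.LFunctions.SchoenfeldZeroSums
import Mathlib.Analysis.SpecialFunctions.Log.Monotone
import HarnessLib

/-!
# The far-zero bound (6.4) of Mossinghoff–Trudgian–Yang (= Ford 2002, (9.2)) from the Riemann–von Mangoldt formula (3.8)

Topic `Literature/NumberTheory/LFunctions`. Part of the decomposition of the named facts
`Literature.NumberTheory.LFunctions.zero_inequality_intermediate_mossinghoff_trudgian_yang`
(Lemma 6.1) and `Literature.NumberTheory.LFunctions.zero_free_region_intermediate_mossinghoff_trudgian_yang`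
(Theorem 1.4) of Mossinghoff–Trudgian–Yang, *Res. Number Theory* 10 (2024) = arXiv:2212.06867
(arXiv numbering). Everything here is PROVED; no named fact is introduced (the Riemann–von
Mangoldt formula (3.8) = Hasanalizade–Shen–Wong, Cor. 1.2, the tree's named fact
`zetaZeroCount_hasanalizade_shen_wong`, enters as a hypothesis `h`).

**The result.** The proof of Lemma 6.1 (§6, (6.4)) uses, "by [Ford 2002, (9.1)]" (our (9.2) in the
arXiv version), for `t ≥ 10⁴`:
`Σ_{|1+it−ρ| ≥ ½} |1+it−ρ|^{-2} ≤ 3.2357 log t + 5.316 log log t + 16.134 − 4N(t, ½)`,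
which Ford obtains from Rosser's explicit `N(T)` theorem "as in the proof of Lemma 4.3": the zeros
with `|γ − t| ≥ 1` by Stieltjes integration against `N(u)`, the window `|γ − t| < 1` by counting
(`N₂ + N₃ = N(t+1) − N(t−1) − N(t, ½)`, each term `≤ 4`). This file carries out that derivation
from (3.8) instead of Rosser's theorem — `FordFarZeros.farZeroSum_half_of_hsw`: **for
`t ≥ e²⁴⁰` and every finite set `T` of non-trivial zeros with `|1 + it − ρ| > ½`,
`Σ_{ρ ∈ T} m(ρ)/|1+it−ρ|² ≤ 3.2357 log t + 5.316 log log t + 16.134 − 4N(t, ½)`** (with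
multiplicities `m(ρ) = riemannZetaZeroOrder ρ`, `N(t, ½) = fordN t ½`); restated outside the
namespace as `farZeroSum_half_strict_of_hsw` (threshold `e²⁴⁰`) and `…_of_hsw_exp999`
(threshold `e⁹⁹⁹`, the shape of hypothesis `h92` of the Theorem 1.4 assembly). The constant
`9.3675` of (3.8) is much larger than Rosser's `1.588`, so the bound obtained,
`2.838 log t + 3.088 log log t + 112.5 − 4N(t, ½)`, is below Ford's only from `log t ≈ 215` on; we
take `log t ≥ 240` (Lemma 6.1 and Theorem 1.4 live at `log t ≥ 999`).

**Strict versus closed far sums.** The window count subtracts the CLOSED-disc count `N(t, ½)`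
(the `N(jt, ½)` of (6.5), (6.8)), so the bound is for the sum over `|1 + it − ρ| > ½`; a zero
exactly on the circle would break it by `4m(ρ)`. This is also what the proof of the smoothed zero
detector (MTY Lemma 4.2) produces (each zero enters once: near `≤ η`, far `> η`); the printed
"`Σ_{|s−ρ| ≥ η}`" double-counts circle zeros, harmlessly there but not here.

## Contents (namespace `FordFarZeros`)

* `window_sum_le` — `t − 1 < γ ≤ t + 1`: `Σ ≤ 4(N(t+1) − N(t−1) − N(t, ½))` (disjointness of
  `T` and the near disc inside the window; `zetaZeroCount_sub_eq_sum`).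
* `rvmMain u = (u/2π) log(u/2πe)` (the main term of (3.8)), `hasDerivAt_rvmMain`
  (`M' = (1/2π) log(u/2π)`), `monotoneOn_rvmMain`, `rvmMain_le` (`M(u) ≤ u log u`).
* `lower_tail_sum_le` — `0 < γ ≤ t − 1` (Ford's `I₂`): exact partial summation
  (`SchoenfeldBound.sum_zerosBetween_eq`) of `(t − γ)^{-2}` on `(0, t−1]`, integration by parts of
  `M`: `Σ ≤ 2Q + (1/2π) log(t/2π)`.
* `upper_tail_sum_le` — `γ > t + 1` (Ford's `I₁`): `SchoenfeldBound.sum_zerosBetween_le_of_count_le`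
  on `(t+1, U]`, by parts (`integral_rvm_parts_le`, the log kernel `integral_logKernel_le`:
  `∫_{t+1}^∞ log u/(u−t)² ≤ (1 + 1/t) log(t+1)`), the `q`-part (`integral_lin_le`), and `U → ∞`
  (`boundary_small`, `le_of_forall_pos_le_add`):
  `Σ ≤ (1/2π)(1 + 1/t) log(t+1) + q(t+1) + Q + (a+b)/(t+1)`.
* `neg_ordinates_sum_le` — `γ < 0` (Ford's `I₃`, negligible): conjugation (`m(ρ̄) = m(ρ)`,
  `riemannZetaZeroOrder_conj_holds`) and partial summation of `(t + γ)^{-2}` with the crude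
  `N(u) ≤ u log(u+1) + 10`: `Σ ≤ (3 log t + 2)/t + 20/t²`.
* `hsw_bounds`, `count_le_crude`, `window_count_le` (mean value theorem for `M`) — the inputs
  from (3.8); `farZeroSum_half_of_hsw` — the assembly (partition of `T` by `γ`, no zero with
  `γ = 0` by `riemannZeta_ne_zero_of_im_eq_zero_of_pos_of_lt_one`, numerics at `log t ≥ 240`).

## References

* K. Ford, *Zero-free regions for the Riemann zeta function*, Number Theory for the Millennium II
  (Urbana, IL, 2000), A K Peters 2002, 25–56 = arXiv:1910.08205: Lemma 4.3 (proof) and (9.2)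
  (`Ford2002Millennium`).
* M. J. Mossinghoff, T. S. Trudgian, A. Yang, *Explicit zero-free regions for the Riemann
  zeta-function*, Res. Number Theory 10 (2024), no. 11 = arXiv:2212.06867: (3.8), §6 (6.4)
  (`MossinghoffTrudgianYangRNT2024`).
* E. Hasanalizade, Q. Shen, P.-J. Wong, *Counting zeros of the Riemann zeta function*, J. Number
  Theory 235 (2022), 219–241, Cor. 1.2 (`HasanalizadeShenWong2022`).
-/

noncomputable section

open Complex Real MeasureTheory Finset Set Filter
open scoped Topology

namespace Literature.NumberTheory.LFunctions

namespace FordFarZeros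

open SchoenfeldBound

/-! ## The window `t − 1 < Im ρ ≤ t + 1`: `Σ ≤ 4(N(t+1) − N(t−1) − N(t, ½))` -/

/-- A zero of `ζ` in the closed disc `|1 + it − ρ| ≤ ½` lies in the window `t − 1 < Im ρ ≤ t + 1`
of the critical strip (`½ ≤ Re ρ < 1`). [folklore] -/
theorem near_mem_zerosBetween {t : ℝ} (ht : 1 ≤ t) {ρ : ℂ} (hρ : ρ ∈ fordNearZeros t (1 / 2)) :
    ρ ∈ zerosBetween (t - 1) (t + 1) := by
  rw [mem_fordNearZeros] at hρ
  obtain ⟨hz, hn⟩ := hρ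
  have hre := Complex.abs_re_le_norm (1 + t * I - ρ)
  have him := Complex.abs_im_le_norm (1 + t * I - ρ)
  simp only [Complex.sub_re, Complex.add_re, Complex.one_re, Complex.mul_re, Complex.ofReal_re,
    Complex.I_re, mul_zero, Complex.ofReal_im, Complex.I_im, mul_one, sub_self, add_zero,
    Complex.sub_im, Complex.add_im, Complex.one_im, Complex.mul_im, zero_add] at hre him
  rw [abs_le] at hre him
  have hre1 : ρ.re ≤ 1 := by
    by_contra h
    exact riemannZeta_ne_zero_of_one_le_re (s := ρ) (by linarith) hz
  rw [mem_zerosBetween (by linarith)]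
  exact ⟨hz, by linarith, hre1, by linarith, by linarith⟩

/-- **The window bound.** For `t ≥ 1` and a finite set `T` of zeros of `ζ` with
`0 < Re ρ < 1`, `½ < |1 + it − ρ|` and `t − 1 < Im ρ ≤ t + 1`:
`Σ_{ρ ∈ T} m(ρ)/|1+it−ρ|² ≤ 4(N(t+1) − N(t−1) − N(t, ½))` (each term is `< 4m(ρ)`, and `T` and
the closed disc are disjoint sets of zeros of the window, whose total multiplicity is
`N(t+1) − N(t−1)`). [cite: Ford2002Millennium, Lemma 4.3 (proof: N₂ + N₃)] -/
theorem window_sum_le {t : ℝ} (ht : 1 ≤ t) (T : Finset ℂ)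
    (hT : ∀ ρ ∈ T, riemannZeta ρ = 0 ∧ 0 < ρ.re ∧ ρ.re < 1 ∧ 1 / 2 < ‖1 + t * I - ρ‖)
    (hW : ∀ ρ ∈ T, t - 1 < ρ.im ∧ ρ.im ≤ t + 1) :
    ∑ ρ ∈ T, (riemannZetaZeroOrder ρ : ℝ) / ‖1 + t * I - ρ‖ ^ 2 ≤
      4 * ((zetaZeroCount (t + 1) : ℝ) - zetaZeroCount (t - 1) - fordN t (1 / 2)) := by
  classical
  have hm : ∀ ρ ∈ T, (0 : ℝ) ≤ riemannZetaZeroOrder ρ := fun ρ hρ ↦ by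
    exact_mod_cast riemannZetaZeroOrder_nonneg fun h1 ↦ riemannZeta_one_ne_zero (h1 ▸ (hT ρ hρ).1)
  -- each term is at most `4 m(ρ)`
  have hterm : ∀ ρ ∈ T, (riemannZetaZeroOrder ρ : ℝ) / ‖1 + t * I - ρ‖ ^ 2 ≤ 4 * riemannZetaZeroOrder ρ := by
    intro ρ hρ
    have h := (hT ρ hρ).2.2.2
    have h4 : 1 / 4 ≤ ‖1 + t * I - ρ‖ ^ 2 := by nlinarith
    rw [div_le_iff₀ (by positivity)]
    nlinarith [hm ρ hρ]
  -- `T` and the near disc inside the window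
  have hTsub : T ⊆ zerosBetween (t - 1) (t + 1) := by
    intro ρ hρ
    obtain ⟨hz, h0, h1, -⟩ := hT ρ hρ
    rw [mem_zerosBetween (by linarith)]
    exact ⟨hz, h0.le, h1.le, (hW ρ hρ).1, (hW ρ hρ).2⟩
  have hNsub : fordNearZeros t (1 / 2) ⊆ zerosBetween (t - 1) (t + 1) :=
    fun ρ hρ ↦ near_mem_zerosBetween ht hρ
  have hdisj : Disjoint T (fordNearZeros t (1 / 2)) := by
    rw [Finset.disjoint_left]
    intro ρ h1 h2
    rw [mem_fordNearZeros] at h2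
    linarith [(hT ρ h1).2.2.2, h2.2]
  have hunion : T ∪ fordNearZeros t (1 / 2) ⊆ zerosBetween (t - 1) (t + 1) :=
    Finset.union_subset hTsub hNsub
  have hmB : ∀ ρ ∈ zerosBetween (t - 1) (t + 1), (0 : ℝ) ≤ riemannZetaZeroOrder ρ := by
    intro ρ hρ
    rw [mem_zerosBetween (by linarith)] at hρ
    exact_mod_cast riemannZetaZeroOrder_nonneg fun h1 ↦ riemannZeta_one_ne_zero (h1 ▸ hρ.1)
  have hcount : ∑ ρ ∈ T, (riemannZetaZeroOrder ρ : ℝ) + fordN t (1 / 2)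
      ≤ (zetaZeroCount (t + 1) : ℝ) - zetaZeroCount (t - 1) := by
    rw [zetaZeroCount_sub_eq_sum (by linarith : t - 1 ≤ t + 1), fordN,
      ← Finset.sum_union hdisj]
    exact Finset.sum_le_sum_of_subset_of_nonneg hunion fun ρ hρ _ ↦ hmB ρ hρ
  calc ∑ ρ ∈ T, (riemannZetaZeroOrder ρ : ℝ) / ‖1 + t * I - ρ‖ ^ 2
      ≤ ∑ ρ ∈ T, 4 * (riemannZetaZeroOrder ρ : ℝ) := Finset.sum_le_sum hterm
    _ = 4 * ∑ ρ ∈ T, (riemannZetaZeroOrder ρ : ℝ) := by rw [Finset.mul_sum]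
    _ ≤ _ := by linarith

/-! ## The Riemann–von Mangoldt main term -/

/-- The main term `M(u) = (u/2π) log(u/(2πe))` of the Riemann–von Mangoldt formula in the form
(3.8) of Mossinghoff–Trudgian–Yang (Hasanalizade–Shen–Wong, Cor. 1.2).
[cite: MossinghoffTrudgianYangRNT2024, (3.8)] -/
def rvmMain (u : ℝ) : ℝ := u / (2 * π) * Real.log (u / (2 * π * Real.exp 1))

/-- `M'(u) = (1/2π) log(u/2π)` for `u > 0`. [folklore] -/
theorem hasDerivAt_rvmMain {u : ℝ} (hu : 0 < u) :
    HasDerivAt rvmMain (1 / (2 * π) * Real.log (u / (2 * π))) u := by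
  have hπ := Real.pi_pos
  have hc : (0 : ℝ) < 2 * π * Real.exp 1 := by positivity
  have h1 : HasDerivAt (fun v : ℝ ↦ v / (2 * π)) (1 / (2 * π)) u := by
    simpa using (hasDerivAt_id u).div_const (2 * π)
  have h2 : HasDerivAt (fun v : ℝ ↦ Real.log (v / (2 * π * Real.exp 1))) (1 / u) u := by
    have h := ((hasDerivAt_id' u).div_const (2 * π * Real.exp 1)).log (by positivity)
    refine h.congr_deriv ?_
    field_simp
  have h := h1.mul h2
  refine h.congr_deriv ?_
  have hlog : Real.log (u / (2 * π * Real.exp 1)) = Real.log (u / (2 * π)) - 1 := by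
    rw [Real.log_div hu.ne' hc.ne', Real.log_div hu.ne' (by positivity), Real.log_mul (by positivity) (by positivity),
      Real.log_exp]
    ring
  rw [hlog]
  field_simp
  ring

/-- `M` is continuous on `(0, ∞)`. [folklore] -/
theorem continuousOn_rvmMain : ContinuousOn rvmMain (Ioi 0) := fun _ hu ↦
  (hasDerivAt_rvmMain hu).continuousAt.continuousWithinAt

/-- `M(e) ≤ 0` (`= (e/2π) log(1/2π)`). [folklore] -/
theorem rvmMain_exp_one_nonpos : rvmMain (Real.exp 1) ≤ 0 := by
  unfold rvmMain
  have hπ := Real.pi_gt_three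
  have he := Real.exp_pos (1 : ℝ)
  have hlog : Real.log (Real.exp 1 / (2 * π * Real.exp 1)) ≤ 0 := by
    apply Real.log_nonpos (by positivity)
    rw [div_le_one (by positivity)]
    nlinarith
  exact mul_nonpos_of_nonneg_of_nonpos (by positivity) hlog

/-! ## The lower tail `0 < Im ρ ≤ t − 1` (Ford's `I₂`) -/

/-- **The lower tail.** For `t ≥ 10` and a finite set `T` of zeros of `ζ` with `0 < Re ρ < 1` and
`0 < Im ρ ≤ t − 1`, if `N(u) ≥ M(u) − Q` on `[e, t − 1]` and `N(t − 1) ≤ M(t − 1) + Q` (`Q ≥ 0`),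
then `Σ_{ρ ∈ T} m(ρ)/|1+it−ρ|² ≤ 2Q + (1/2π) log(t/2π)` (partial summation of `(t − γ)^{-2}`
against `N`, as in Ford's bound for `I₂`). [cite: Ford2002Millennium, Lemma 4.3 (proof: I₂)] -/
theorem lower_tail_sum_le {t Q : ℝ} (ht : 10 ≤ t) (hQ : 0 ≤ Q) (T : Finset ℂ)
    (hT : ∀ ρ ∈ T, riemannZeta ρ = 0 ∧ 0 < ρ.re ∧ ρ.re < 1)
    (hW : ∀ ρ ∈ T, 0 < ρ.im ∧ ρ.im ≤ t - 1)
    (hlo : ∀ u ∈ Icc (Real.exp 1) (t - 1), rvmMain u - Q ≤ (zetaZeroCount u : ℝ))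
    (hup : (zetaZeroCount (t - 1) : ℝ) ≤ rvmMain (t - 1) + Q) :
    ∑ ρ ∈ T, (riemannZetaZeroOrder ρ : ℝ) / ‖1 + t * I - ρ‖ ^ 2 ≤
      2 * Q + 1 / (2 * π) * Real.log (t / (2 * π)) := by
  classical
  have hπ := Real.pi_pos
  have hπ3 := Real.pi_gt_three
  have he1 : Real.exp 1 < 3 := lt_trans Real.exp_one_lt_d9 (by norm_num)
  have he0 : 0 < Real.exp 1 := Real.exp_pos 1
  set f : ℝ → ℝ := fun u ↦ 1 / (t - u) ^ 2 with hf
  set f' : ℝ → ℝ := fun u ↦ 2 / (t - u) ^ 3 with hf'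
  -- calculus of `f`
  have hfd : ∀ u, u < t → HasDerivAt f (f' u) u := by
    intro u hu
    have hne : t - u ≠ 0 := by linarith
    have h1 : HasDerivAt (fun v : ℝ ↦ (t - v) ^ 2) (((2 : ℕ) : ℝ) * (t - u) ^ (2 - 1) * (-1)) u :=
      ((hasDerivAt_id' u).const_sub t).pow 2
    have h := (hasDerivAt_const u (1 : ℝ)).div h1 (pow_ne_zero 2 hne)
    refine h.congr_deriv ?_
    simp only [hf']
    field_simp
    ring
  have hfcont : ContinuousOn f (Iio t) :=
    continuousOn_const.div ((continuousOn_const.sub continuousOn_id).pow 2) fun u hu ↦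
      pow_ne_zero 2 (by rw [Set.mem_Iio] at hu; exact sub_ne_zero.2 (ne_of_gt hu))
  have hf'cont : ContinuousOn f' (Iio t) :=
    continuousOn_const.div ((continuousOn_const.sub continuousOn_id).pow 3) fun u hu ↦
      pow_ne_zero 3 (by rw [Set.mem_Iio] at hu; exact sub_ne_zero.2 (ne_of_gt hu))
  have hIcc0 : Icc 0 (t - 1) ⊆ Iio t := fun u hu ↦ by rw [Set.mem_Iio]; linarith [hu.2]
  have hIccE : Icc (Real.exp 1) (t - 1) ⊆ Iio t := fun u hu ↦ by rw [Set.mem_Iio]; linarith [hu.2]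
  have huIcc : ∀ a b : ℝ, a ≤ t - 1 → b ≤ t - 1 → Set.uIcc a b ⊆ Iio t := by
    intro a b ha hb u hu
    rw [Set.mem_uIcc] at hu
    rw [Set.mem_Iio]
    rcases hu with h | h <;> linarith [h.2]
  have hf'c : ContinuousOn f' (Icc 0 (t - 1)) := hf'cont.mono hIcc0
  have hf'c2 : ContinuousOn f' (Icc (Real.exp 1) (t - 1)) := hf'cont.mono hIccE
  have hfc2 : ContinuousOn f (Icc (Real.exp 1) (t - 1)) := hfcont.mono hIccE
  have hf'nn : ∀ u ∈ Icc 0 (t - 1), 0 ≤ f' u := fun u hu ↦ by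
    simp only [hf']; exact div_nonneg (by norm_num) (pow_nonneg (by linarith [hu.2]) 3)
  have hm : ∀ ρ ∈ T, (0 : ℝ) ≤ riemannZetaZeroOrder ρ := fun ρ hρ ↦ by
    exact_mod_cast riemannZetaZeroOrder_nonneg fun h1 ↦ riemannZeta_one_ne_zero (h1 ▸ (hT ρ hρ).1)
  -- Step 1: `Σ_T ≤ Σ_{zerosBetween 0 (t-1)} m f(γ)`
  have hTsub : T ⊆ zerosBetween 0 (t - 1) := by
    intro ρ hρ
    obtain ⟨hz, h0, h1⟩ := hT ρ hρ
    rw [mem_zerosBetween le_rfl]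
    exact ⟨hz, h0.le, h1.le, (hW ρ hρ).1, (hW ρ hρ).2⟩
  have hmB : ∀ ρ ∈ zerosBetween 0 (t - 1), (0 : ℝ) ≤ riemannZetaZeroOrder ρ := by
    intro ρ hρ
    rw [mem_zerosBetween le_rfl] at hρ
    exact_mod_cast riemannZetaZeroOrder_nonneg fun h1 ↦ riemannZeta_one_ne_zero (h1 ▸ hρ.1)
  have hstep1 : ∑ ρ ∈ T, (riemannZetaZeroOrder ρ : ℝ) / ‖1 + t * I - ρ‖ ^ 2 ≤
      ∑ ρ ∈ zerosBetween 0 (t - 1), (riemannZetaZeroOrder ρ : ℝ) * f ρ.im := by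
    have h1 : ∀ ρ ∈ T, (riemannZetaZeroOrder ρ : ℝ) / ‖1 + t * I - ρ‖ ^ 2 ≤
        (riemannZetaZeroOrder ρ : ℝ) * f ρ.im := by
      intro ρ hρ
      have him := Complex.abs_im_le_norm (1 + t * I - ρ)
      have e : (1 + t * I - ρ).im = t - ρ.im := by simp
      rw [e] at him
      have hpos : 0 < t - ρ.im := by linarith [(hW ρ hρ).2]
      rw [abs_of_pos hpos] at him
      simp only [hf, mul_one_div]
      apply div_le_div_of_nonneg_left (hm ρ hρ) (by positivity)
      exact pow_le_pow_left₀ hpos.le him 2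
    calc _ ≤ ∑ ρ ∈ T, (riemannZetaZeroOrder ρ : ℝ) * f ρ.im := Finset.sum_le_sum h1
      _ ≤ _ := Finset.sum_le_sum_of_subset_of_nonneg hTsub fun ρ hρ _ ↦
          mul_nonneg (hmB ρ hρ) (by simp only [hf]; positivity)
  -- Step 2: partial summation
  have hN0 : (zetaZeroCount 0 : ℝ) = 0 := by
    rw [zetaZeroCount_eq_zero_of_nonpos le_rfl]; simp
  have hps := sum_zerosBetween_eq (T₁ := 0) (T₂ := t - 1) le_rfl (by linarith) (f := f) (f' := f')
    (fun u hu ↦ hfd u (by linarith [hu.2])) hf'c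
  rw [hN0, sub_zero] at hps
  have hft : f (t - 1) = 1 := by simp [hf]
  rw [hft, mul_one] at hps
  simp_rw [sub_zero] at hps
  -- Step 3: lower bound for `∫_0^{t-1} N f'`
  have hintN : ∀ a b, a ≤ t - 1 → b ≤ t - 1 →
      IntervalIntegrable (fun u ↦ (zetaZeroCount u : ℝ) * f' u) volume a b := by
    intro a b ha hb
    have h := intervalIntegrable_count_sub_mul (T₁ := 0) (a := a) (b := b) (hf'cont.mono (huIcc a b ha hb))
    simp_rw [hN0, sub_zero] at h
    exact h
  have hsplit : ∫ u in (0 : ℝ)..(t - 1), (zetaZeroCount u : ℝ) * f' u =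
      (∫ u in (0 : ℝ)..Real.exp 1, (zetaZeroCount u : ℝ) * f' u)
        + ∫ u in Real.exp 1..(t - 1), (zetaZeroCount u : ℝ) * f' u :=
    (intervalIntegral.integral_add_adjacent_intervals (hintN _ _ (by linarith) (by linarith))
      (hintN _ _ (by linarith) le_rfl)).symm
  have hI1 : 0 ≤ ∫ u in (0 : ℝ)..Real.exp 1, (zetaZeroCount u : ℝ) * f' u := by
    refine intervalIntegral.integral_nonneg he0.le fun u hu ↦ mul_nonneg (Nat.cast_nonneg _) ?_
    exact hf'nn u ⟨hu.1, by linarith [hu.2]⟩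
  -- on `[e, t-1]`: `N f' ≥ (M - Q) f'`
  have hMcont : ContinuousOn rvmMain (Icc (Real.exp 1) (t - 1)) :=
    continuousOn_rvmMain.mono fun u hu ↦ he0.trans_le hu.1
  have hI2 : ∫ u in Real.exp 1..(t - 1), (rvmMain u - Q) * f' u ≤
      ∫ u in Real.exp 1..(t - 1), (zetaZeroCount u : ℝ) * f' u := by
    refine intervalIntegral.integral_mono_on (by linarith) ?_ (hintN _ _ (by linarith) le_rfl) fun u hu ↦ ?_
    · exact ((hMcont.sub continuousOn_const).mul hf'c2).intervalIntegrable_of_Icc (by linarith)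
    · exact mul_le_mul_of_nonneg_right (hlo u hu) (hf'nn u ⟨he0.le.trans hu.1, hu.2⟩)
  -- by parts for `∫ M f'`
  have hfd' : ∀ u ∈ Set.uIcc (Real.exp 1) (t - 1), HasDerivAt f (f' u) u := by
    intro u hu
    rw [Set.uIcc_of_le (by linarith)] at hu
    exact hfd u (by linarith [hu.2])
  have hMd : ∀ u ∈ Set.uIcc (Real.exp 1) (t - 1),
      HasDerivAt rvmMain (1 / (2 * π) * Real.log (u / (2 * π))) u := by
    intro u hu
    rw [Set.uIcc_of_le (by linarith)] at hu
    exact hasDerivAt_rvmMain (he0.trans_le hu.1)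
  have hM'c : ContinuousOn (fun u ↦ 1 / (2 * π) * Real.log (u / (2 * π)))
      (Icc (Real.exp 1) (t - 1)) := by
    refine continuousOn_const.mul ((continuousOn_id.div_const _).log fun u hu ↦ ?_)
    have : 0 < u := he0.trans_le hu.1
    positivity
  have hparts := intervalIntegral.integral_mul_deriv_eq_deriv_mul hMd hfd'
    (hM'c.intervalIntegrable_of_Icc (by linarith)) (hf'c2.intervalIntegrable_of_Icc (by linarith))
  -- `∫ f = 1 - 1/(t - e) ≤ 1` on `[e, t - 1]`
  have hπ4 := Real.pi_lt_d2
  have hlogt : 0 ≤ Real.log (t / (2 * π)) :=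
    Real.log_nonneg (by rw [le_div_iff₀ (by positivity)]; linarith)
  have hfint : ∫ u in Real.exp 1..(t - 1), f u = (1 : ℝ) - 1 / (t - Real.exp 1) := by
    have hFd : ∀ u ∈ Set.uIcc (Real.exp 1) (t - 1), HasDerivAt (fun v ↦ 1 / (t - v)) (f u) u := by
      intro u hu
      rw [Set.uIcc_of_le (by linarith)] at hu
      have hne : t - u ≠ 0 := by linarith [hu.2]
      have h := (hasDerivAt_const u (1 : ℝ)).div ((hasDerivAt_id' u).const_sub t) hne
      refine h.congr_deriv ?_
      simp only [hf]
      field_simp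
      ring
    rw [intervalIntegral.integral_eq_sub_of_hasDerivAt hFd (hfc2.intervalIntegrable_of_Icc (by linarith))]
    have : t - (t - 1) = 1 := by ring
    rw [this]
    ring
  have hM'f : ∫ u in Real.exp 1..(t - 1), 1 / (2 * π) * Real.log (u / (2 * π)) * f u ≤
      1 / (2 * π) * Real.log (t / (2 * π)) * 1 := by
    have h1 : ∫ u in Real.exp 1..(t - 1), 1 / (2 * π) * Real.log (u / (2 * π)) * f u ≤
        ∫ u in Real.exp 1..(t - 1), 1 / (2 * π) * Real.log (t / (2 * π)) * f u := by
      refine intervalIntegral.integral_mono_on (by linarith) ?_ ?_ fun u hu ↦ ?_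
      · exact (hM'c.mul hfc2).intervalIntegrable_of_Icc (by linarith)
      · exact (continuousOn_const.mul hfc2).intervalIntegrable_of_Icc (by linarith)
      · have hu0 : 0 < u := he0.trans_le hu.1
        have hfu : 0 ≤ f u := by simp only [hf]; positivity
        have hlog : Real.log (u / (2 * π)) ≤ Real.log (t / (2 * π)) :=
          Real.log_le_log (by positivity) (by
            rw [div_le_div_iff_of_pos_right (by positivity)]; linarith [hu.2])
        exact mul_le_mul_of_nonneg_right (mul_le_mul_of_nonneg_left hlog (by positivity)) hfu
    rw [intervalIntegral.integral_const_mul, hfint] at h1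
    have h2 : (1 : ℝ) - 1 / (t - Real.exp 1) ≤ 1 := by
      have : 0 < t - Real.exp 1 := by linarith
      have : 0 ≤ 1 / (t - Real.exp 1) := by positivity
      linarith
    calc _ ≤ 1 / (2 * π) * Real.log (t / (2 * π)) * (1 - 1 / (t - Real.exp 1)) := h1
      _ ≤ _ := mul_le_mul_of_nonneg_left h2 (by positivity)
  -- `∫ (M - Q) f' = ∫ M f' - Q (f(t-1) - f(e))`
  have hQf : ∫ u in Real.exp 1..(t - 1), (rvmMain u - Q) * f' u =
      (∫ u in Real.exp 1..(t - 1), rvmMain u * f' u) - Q * (f (t - 1) - f (Real.exp 1)) := by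
    have hi1 : IntervalIntegrable (fun u ↦ rvmMain u * f' u) volume (Real.exp 1) (t - 1) :=
      (hMcont.mul hf'c2).intervalIntegrable_of_Icc (by linarith)
    have hi2 : IntervalIntegrable (fun u ↦ Q * f' u) volume (Real.exp 1) (t - 1) :=
      (continuousOn_const.mul hf'c2).intervalIntegrable_of_Icc (by linarith)
    have e : (fun u ↦ (rvmMain u - Q) * f' u) = fun u ↦ rvmMain u * f' u - Q * f' u := by
      funext u; ring
    rw [e, intervalIntegral.integral_sub hi1 hi2, intervalIntegral.integral_const_mul,
      intervalIntegral.integral_eq_sub_of_hasDerivAt hfd' (hf'c2.intervalIntegrable_of_Icc (by linarith))]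
  have hfe : 0 ≤ f (Real.exp 1) := by simp only [hf]; positivity
  have hMe := rvmMain_exp_one_nonpos
  -- final
  have hsum_le : ∑ ρ ∈ zerosBetween 0 (t - 1), (riemannZetaZeroOrder ρ : ℝ) * f ρ.im ≤
      2 * Q + 1 / (2 * π) * Real.log (t / (2 * π)) := by
    rw [hps, hsplit]
    have hkey : rvmMain (t - 1) - 1 / (2 * π) * Real.log (t / (2 * π)) - Q ≤
        ∫ u in Real.exp 1..(t - 1), (zetaZeroCount u : ℝ) * f' u := by
      refine le_trans ?_ hI2
      rw [hQf, hparts, hft]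
      have h3 : rvmMain (Real.exp 1) * f (Real.exp 1) ≤ 0 := mul_nonpos_of_nonpos_of_nonneg hMe hfe
      have h4 : Q * (1 - f (Real.exp 1)) ≤ Q := by nlinarith
      linarith [hM'f, h3, h4]
    linarith [hup, hI1, hkey]
  exact hstep1.trans hsum_le

/-! ## Elementary helpers for the upper tail -/

/-- `log y − log x ≤ y − x` for `1 ≤ x ≤ y`. [folklore] -/
theorem log_sub_log_le {x y : ℝ} (hx : 1 ≤ x) (hxy : x ≤ y) : Real.log y - Real.log x ≤ y - x := by
  have hx0 : 0 < x := by linarith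
  have hy0 : 0 < y := by linarith
  have h := Real.log_le_sub_one_of_pos (show 0 < y / x by positivity)
  rw [Real.log_div hy0.ne' hx0.ne'] at h
  have h2 : y / x - 1 ≤ y - x := by
    rw [div_sub_one hx0.ne', div_le_iff₀ hx0]
    nlinarith
  linarith

/-- `log u ≤ 2√u` for `u ≥ 0`. [folklore] -/
theorem log_le_two_sqrt {u : ℝ} (hu : 0 < u) : Real.log u ≤ 2 * Real.sqrt u := by
  have h := Real.log_le_sub_one_of_pos (Real.sqrt_pos.2 hu)
  rw [Real.log_sqrt hu.le] at h
  linarith [Real.sqrt_nonneg u]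

/-- `M` is monotone on `[2π, ∞)` (`M' = (1/2π) log(u/2π) ≥ 0` there). [folklore] -/
theorem monotoneOn_rvmMain : MonotoneOn rvmMain (Ici (2 * π)) := by
  have hπ := Real.pi_pos
  refine monotoneOn_of_hasDerivWithinAt_nonneg (convex_Ici _) (f' := fun u ↦ 1 / (2 * π) * Real.log (u / (2 * π)))
    (continuousOn_rvmMain.mono fun u hu ↦ lt_of_lt_of_le (by positivity) (mem_Ici.1 hu)) ?_ ?_
  · intro u hu
    rw [interior_Ici] at hu ⊢
    exact (hasDerivAt_rvmMain (lt_trans (by positivity) hu)).hasDerivWithinAt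
  · intro u hu
    rw [interior_Ici] at hu
    have : 1 ≤ u / (2 * π) := by rw [le_div_iff₀ (by positivity)]; linarith [mem_Ioi.1 hu]
    exact mul_nonneg (by positivity) (Real.log_nonneg this)

/-- `M(u) ≤ u log u` for `u ≥ 1`. [folklore] -/
theorem rvmMain_le {u : ℝ} (hu : 1 ≤ u) : rvmMain u ≤ u * Real.log u := by
  have hπ := Real.pi_gt_three
  have hu0 : 0 < u := by linarith
  unfold rvmMain
  have h1 : Real.log (u / (2 * π * Real.exp 1)) ≤ Real.log u := by
    apply Real.log_le_log (by positivity)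
    rw [div_le_iff₀ (by positivity)]
    have : 1 ≤ 2 * π * Real.exp 1 := by nlinarith [Real.add_one_le_exp (1 : ℝ)]
    nlinarith
  have hlog0 : 0 ≤ Real.log u := Real.log_nonneg hu
  rcases le_or_gt 0 (Real.log (u / (2 * π * Real.exp 1))) with h | h
  · calc u / (2 * π) * Real.log (u / (2 * π * Real.exp 1)) ≤ u / (2 * π) * Real.log u :=
          mul_le_mul_of_nonneg_left h1 (by positivity)
      _ ≤ u * Real.log u := by
          apply mul_le_mul_of_nonneg_right _ hlog0
          rw [div_le_iff₀ (by positivity)]; nlinarith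
  · have : u / (2 * π) * Real.log (u / (2 * π * Real.exp 1)) ≤ 0 :=
      mul_nonpos_of_nonneg_of_nonpos (by positivity) h.le
    nlinarith

/-- An antiderivative of `log u/(u − t)²` on `u > t > 0`:
`F(u) = −log u/(u − t) + (log(u − t) − log u)/t`. [folklore] -/
theorem hasDerivAt_logKernel {t u : ℝ} (ht : 0 < t) (hu : t < u) :
    HasDerivAt (fun v ↦ -Real.log v / (v - t) + (Real.log (v - t) - Real.log v) / t)
      (Real.log u / (u - t) ^ 2) u := by
  have hu0 : 0 < u := ht.trans hu
  have hut : u - t ≠ 0 := by linarith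
  have h1 := ((Real.hasDerivAt_log hu0.ne').neg).div ((hasDerivAt_id' u).sub_const t) hut
  have h2 := ((((hasDerivAt_id' u).sub_const t).log hut).sub (Real.hasDerivAt_log hu0.ne')).div_const t
  refine (h1.add h2).congr_deriv ?_
  simp only [Pi.neg_apply]
  field_simp
  ring

/-! ## The upper tail `Im ρ > t + 1` (Ford's `I₁`): three integral lemmas and a limit -/

/-- `∫_{t+1}^U log u/(u−t)² du ≤ (1 + 1/t) log(t+1)` (`0 < t`, `t + 1 ≤ U`). [folklore] -/
theorem integral_logKernel_le {t U : ℝ} (ht : 0 < t) (hU : t + 1 ≤ U) :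
    ∫ u in (t + 1)..U, Real.log u / (u - t) ^ 2 ≤ (1 + 1 / t) * Real.log (t + 1) := by
  have hFd : ∀ u ∈ Set.uIcc (t + 1) U, HasDerivAt
      (fun v ↦ -Real.log v / (v - t) + (Real.log (v - t) - Real.log v) / t)
      (Real.log u / (u - t) ^ 2) u := by
    intro u hu
    rw [Set.uIcc_of_le hU] at hu
    exact hasDerivAt_logKernel ht (by linarith [hu.1])
  have hcont : ContinuousOn (fun u ↦ Real.log u / (u - t) ^ 2) (Set.uIcc (t + 1) U) := by
    rw [Set.uIcc_of_le hU]
    exact (continuousOn_log.mono fun u hu ↦ show u ≠ 0 from by linarith [hu.1]).div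
      ((continuousOn_id.sub continuousOn_const).pow 2)
      fun u hu ↦ pow_ne_zero 2 (sub_ne_zero.2 (ne_of_gt (show t < u by linarith [hu.1])))
  rw [intervalIntegral.integral_eq_sub_of_hasDerivAt hFd hcont.intervalIntegrable]
  have hUt : 0 < U - t := by linarith
  have hlogU : 0 ≤ Real.log U := Real.log_nonneg (by linarith)
  have h1 : -Real.log U / (U - t) ≤ 0 := div_nonpos_of_nonpos_of_nonneg (by linarith) hUt.le
  have h2 : (Real.log (U - t) - Real.log U) / t ≤ 0 :=
    div_nonpos_of_nonpos_of_nonneg (by linarith [Real.log_le_log hUt (by linarith : U - t ≤ U)]) ht.le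
  have h3 : Real.log (t + 1 - t) = 0 := by norm_num
  rw [h3]
  have e : (1 + 1 / t) * Real.log (t + 1)
      = -(-Real.log (t + 1) / (t + 1 - t) + (0 - Real.log (t + 1)) / t) := by
    field_simp; ring
  rw [e]
  linarith

/-- `∫_{t+1}^U (M(u) − M(t+1))·2(u−t)^{-3} du ≤ (1/2π)(1 + 1/t) log(t+1)` (`t ≥ 10`, `U ≥ t+1`):
integration by parts (`M` increasing on `[2π, ∞)`) and `integral_logKernel_le`. [folklore] -/
theorem integral_rvm_parts_le {t U : ℝ} (ht : 10 ≤ t) (hU : t + 1 ≤ U) :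
    ∫ u in (t + 1)..U, (rvmMain u - rvmMain (t + 1)) * (2 / (u - t) ^ 3) ≤
      1 / (2 * π) * ((1 + 1 / t) * Real.log (t + 1)) := by
  have hπ := Real.pi_pos
  have hπ4 := Real.pi_lt_d2
  have h3c : ContinuousOn (fun u ↦ 2 / (u - t) ^ 3) (Icc (t + 1) U) :=
    continuousOn_const.div ((continuousOn_id.sub continuousOn_const).pow 3) fun u hu ↦
      pow_ne_zero 3 (sub_ne_zero.2 (ne_of_gt (show t < u by linarith [hu.1])))
  have h2c : ContinuousOn (fun u ↦ -1 / (u - t) ^ 2) (Icc (t + 1) U) :=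
    continuousOn_const.div ((continuousOn_id.sub continuousOn_const).pow 2) fun u hu ↦
      pow_ne_zero 2 (sub_ne_zero.2 (ne_of_gt (show t < u by linarith [hu.1])))
  have hgd : ∀ u ∈ Set.uIcc (t + 1) U, HasDerivAt (fun v ↦ rvmMain v - rvmMain (t + 1))
      (1 / (2 * π) * Real.log (u / (2 * π))) u := by
    intro u hu
    rw [Set.uIcc_of_le hU] at hu
    simpa using (hasDerivAt_rvmMain (show 0 < u by linarith [hu.1])).sub_const (rvmMain (t + 1))
  have hhd : ∀ u ∈ Set.uIcc (t + 1) U, HasDerivAt (fun v ↦ -1 / (v - t) ^ 2) (2 / (u - t) ^ 3) u := by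
    intro u hu
    rw [Set.uIcc_of_le hU] at hu
    have hne : u - t ≠ 0 := by linarith [hu.1]
    have h1 : HasDerivAt (fun v : ℝ ↦ (v - t) ^ 2) (((2 : ℕ) : ℝ) * (u - t) ^ (2 - 1) * 1) u :=
      ((hasDerivAt_id' u).sub_const t).pow 2
    have h := (hasDerivAt_const u (-1 : ℝ)).div h1 (pow_ne_zero 2 hne)
    refine h.congr_deriv ?_
    field_simp
    ring
  have hM'c : ContinuousOn (fun u ↦ 1 / (2 * π) * Real.log (u / (2 * π))) (Icc (t + 1) U) := by
    refine continuousOn_const.mul ((continuousOn_id.div_const _).log fun u hu ↦ ?_)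
    have : 0 < u := by linarith [hu.1]
    positivity
  have hparts := intervalIntegral.integral_mul_deriv_eq_deriv_mul hgd hhd
    (hM'c.intervalIntegrable_of_Icc hU) (h3c.intervalIntegrable_of_Icc hU)
  rw [hparts]
  simp only [sub_self, zero_mul, sub_zero]
  have hmonoM : rvmMain (t + 1) ≤ rvmMain U :=
    monotoneOn_rvmMain (mem_Ici.2 (by linarith)) (mem_Ici.2 (by linarith)) hU
  have hbd : (rvmMain U - rvmMain (t + 1)) * (-1 / (U - t) ^ 2) ≤ 0 := by
    apply mul_nonpos_of_nonneg_of_nonpos (by linarith)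
    exact div_nonpos_of_nonpos_of_nonneg (by norm_num) (by positivity)
  have hK : -∫ u in (t + 1)..U, 1 / (2 * π) * Real.log (u / (2 * π)) * (-1 / (u - t) ^ 2) ≤
      1 / (2 * π) * ((1 + 1 / t) * Real.log (t + 1)) := by
    rw [← intervalIntegral.integral_neg]
    have hlc : ContinuousOn (fun u ↦ Real.log u / (u - t) ^ 2) (Icc (t + 1) U) :=
      (continuousOn_log.mono fun u hu ↦ show u ≠ 0 from by linarith [hu.1]).div
        ((continuousOn_id.sub continuousOn_const).pow 2)
        fun u hu ↦ pow_ne_zero 2 (sub_ne_zero.2 (ne_of_gt (show t < u by linarith [hu.1])))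
    have hmono2 : ∫ u in (t + 1)..U, -(1 / (2 * π) * Real.log (u / (2 * π)) * (-1 / (u - t) ^ 2)) ≤
        ∫ u in (t + 1)..U, 1 / (2 * π) * (Real.log u / (u - t) ^ 2) := by
      refine intervalIntegral.integral_mono_on hU ((hM'c.mul h2c).neg.intervalIntegrable_of_Icc hU)
        ((continuousOn_const.mul hlc).intervalIntegrable_of_Icc hU) fun u hu ↦ ?_
      have hu0 : 0 < u := by linarith [hu.1]
      have hπ3 := Real.pi_gt_three
      have hlog : Real.log (u / (2 * π)) ≤ Real.log u :=
        Real.log_le_log (by positivity) (by rw [div_le_iff₀ (by positivity)]; nlinarith)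
      have e : -(1 / (2 * π) * Real.log (u / (2 * π)) * (-1 / (u - t) ^ 2))
          = 1 / (2 * π) * (Real.log (u / (2 * π)) / (u - t) ^ 2) := by ring
      rw [e]
      exact mul_le_mul_of_nonneg_left (div_le_div_of_nonneg_right hlog (by positivity)) (by positivity)
    refine hmono2.trans ?_
    rw [intervalIntegral.integral_const_mul]
    exact mul_le_mul_of_nonneg_left (integral_logKernel_le (by linarith) hU) (by positivity)
  linarith [hbd, hK]

/-- `∫_{t+1}^U (K₀ + κ(u − t − 1))·2(u−t)^{-3} du ≤ K₀ + κ` (`K₀, κ ≥ 0`, `t + 1 ≤ U`). [folklore] -/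
theorem integral_lin_le {t U K₀ κ : ℝ} (hK : 0 ≤ K₀) (hκ : 0 ≤ κ) (hU : t + 1 ≤ U) :
    ∫ u in (t + 1)..U, (K₀ + κ * (u - t - 1)) * (2 / (u - t) ^ 3) ≤ K₀ + κ := by
  have hGd : ∀ u ∈ Set.uIcc (t + 1) U, HasDerivAt
      (fun v ↦ K₀ * (-1 / (v - t) ^ 2) + κ * (-2 / (v - t) + 1 / (v - t) ^ 2))
      ((K₀ + κ * (u - t - 1)) * (2 / (u - t) ^ 3)) u := by
    intro u hu
    rw [Set.uIcc_of_le hU] at hu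
    have hne : u - t ≠ 0 := by linarith [hu.1]
    have hp2 : HasDerivAt (fun v : ℝ ↦ (v - t) ^ 2) (((2 : ℕ) : ℝ) * (u - t) ^ (2 - 1) * 1) u :=
      ((hasDerivAt_id' u).sub_const t).pow 2
    have hA := ((hasDerivAt_const u (-1 : ℝ)).div hp2 (pow_ne_zero 2 hne)).const_mul K₀
    have hB1 := (hasDerivAt_const u (-2 : ℝ)).div ((hasDerivAt_id' u).sub_const t) hne
    have hB2 := (hasDerivAt_const u (1 : ℝ)).div hp2 (pow_ne_zero 2 hne)
    have hB := (hB1.add hB2).const_mul κ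
    refine (hA.add hB).congr_deriv ?_
    field_simp
    ring
  have hGc : ContinuousOn (fun u ↦ (K₀ + κ * (u - t - 1)) * (2 / (u - t) ^ 3)) (Set.uIcc (t + 1) U) := by
    rw [Set.uIcc_of_le hU]
    refine (Continuous.continuousOn (by fun_prop)).mul ?_
    exact continuousOn_const.div ((continuousOn_id.sub continuousOn_const).pow 3) fun u hu ↦
      pow_ne_zero 3 (sub_ne_zero.2 (ne_of_gt (show t < u by linarith [hu.1])))
  rw [intervalIntegral.integral_eq_sub_of_hasDerivAt hGd hGc.intervalIntegrable]
  have hUt : 0 < U - t := by linarith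
  have e1 : t + 1 - t = 1 := by ring
  rw [e1]
  have h1 : K₀ * (-1 / (U - t) ^ 2) ≤ 0 :=
    mul_nonpos_of_nonneg_of_nonpos hK (div_nonpos_of_nonpos_of_nonneg (by norm_num) (by positivity))
  have h2 : κ * (-2 / (U - t) + 1 / (U - t) ^ 2) ≤ 0 := by
    apply mul_nonpos_of_nonneg_of_nonpos hκ
    have hx : 1 ≤ U - t := by linarith
    have h3 : 1 / (U - t) ^ 2 ≤ 1 / (U - t) := by
      apply one_div_le_one_div_of_le hUt; nlinarith
    have h4 : 0 < 1 / (U - t) := by positivity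
    have e : -2 / (U - t) = -2 * (1 / (U - t)) := by ring
    linarith
  simp only [one_pow, div_one]
  linarith

/-- The boundary term of the partial summation tends to `0`: for every `ε > 0` and `U₀` there is
`U ≥ max(U₀, t + 1)` with `(M(U) + q(U) + C)/(U − t)² ≤ ε` (`q(U) = a log U + b log log U + c`).
[folklore] -/
theorem boundary_small {t a b c C : ℝ} (ht : 1 ≤ t) (ha : 0 ≤ a) (hb : 0 ≤ b) (hc : 0 ≤ c)
    (hC : 0 ≤ C) {ε : ℝ} (hε : 0 < ε) (U₀ : ℝ) :
    ∃ U : ℝ, U₀ ≤ U ∧ t + 1 ≤ U ∧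
      (rvmMain U + (a * Real.log U + b * Real.log (Real.log U) + c) + C) * (1 / (U - t) ^ 2) ≤ ε := by
  set K : ℝ := 2 + 2 * (a + b) + (c + C) with hK
  have hK0 : 0 < K := by positivity
  set U : ℝ := max (max U₀ (2 * t + 2)) ((4 * K / ε) ^ 2 + 1) with hUdef
  have hU0 : U₀ ≤ U := (le_max_left _ _).trans (le_max_left _ _)
  have hU2t : 2 * t + 2 ≤ U := (le_max_right _ _).trans (le_max_left _ _)
  have hUK : (4 * K / ε) ^ 2 + 1 ≤ U := le_max_right _ _
  have hU1 : 1 ≤ U := by linarith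
  have hUpos : 0 < U := by linarith
  refine ⟨U, hU0, by linarith, ?_⟩
  set V : ℝ := Real.sqrt U with hV
  have hV1 : 1 ≤ V := by rw [hV, ← Real.sqrt_one]; exact Real.sqrt_le_sqrt hU1
  have hV0 : 0 < V := by linarith
  have hUV : V * V = U := Real.mul_self_sqrt hUpos.le
  have hUV1 : 1 ≤ U * V := by nlinarith
  -- `f U ≤ 4/U²`
  have hfU : 1 / (U - t) ^ 2 ≤ 4 / U ^ 2 := by
    rw [div_le_div_iff₀ (by nlinarith) (by positivity)]
    nlinarith
  have hfU0 : 0 ≤ 1 / (U - t) ^ 2 := by positivity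
  -- numerator `≤ K U V`
  have hlogU : Real.log U ≤ 2 * V := log_le_two_sqrt hUpos
  have hlogU0 : 0 ≤ Real.log U := Real.log_nonneg hU1
  have hllU : Real.log (Real.log U) ≤ 2 * V := by
    rcases le_or_gt (Real.log U) 1 with h | h
    · have : Real.log (Real.log U) ≤ 0 := Real.log_nonpos hlogU0 h
      linarith
    · have := log_sub_log_le le_rfl h.le
      rw [Real.log_one] at this
      linarith
  have hnum : rvmMain U + (a * Real.log U + b * Real.log (Real.log U) + c) + C ≤ K * (U * V) := by
    have h1 : rvmMain U ≤ U * Real.log U := rvmMain_le hU1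
    have h2 : U * Real.log U ≤ U * (2 * V) := mul_le_mul_of_nonneg_left hlogU hUpos.le
    have h3 : a * Real.log U ≤ a * (2 * V) := mul_le_mul_of_nonneg_left hlogU ha
    have h4 : b * Real.log (Real.log U) ≤ b * (2 * V) := mul_le_mul_of_nonneg_left hllU hb
    have h5 : V ≤ U * V := le_mul_of_one_le_left hV0.le hU1
    have h6 : c + C ≤ (c + C) * (U * V) := le_mul_of_one_le_right (by linarith) hUV1
    have hab : 0 ≤ a + b := by linarith
    have h7 : (a + b) * (2 * V) ≤ (a + b) * (2 * (U * V)) := by nlinarith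
    rw [hK]
    nlinarith
  have hnum0 : 0 ≤ K * (U * V) := by positivity
  calc (rvmMain U + (a * Real.log U + b * Real.log (Real.log U) + c) + C) * (1 / (U - t) ^ 2)
      ≤ K * (U * V) * (4 / U ^ 2) := by
        rcases le_or_gt 0 (rvmMain U + (a * Real.log U + b * Real.log (Real.log U) + c) + C) with h | h
        · exact mul_le_mul hnum hfU hfU0 hnum0
        · have h5 : (rvmMain U + (a * Real.log U + b * Real.log (Real.log U) + c) + C) * (1 / (U - t) ^ 2) ≤ 0 :=
            mul_nonpos_of_nonpos_of_nonneg h.le hfU0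
          have h6 : 0 ≤ K * (U * V) * (4 / U ^ 2) := by positivity
          linarith
    _ = 4 * K / V := by
        field_simp
        nlinarith [hUV]
    _ ≤ ε := by
        rw [div_le_iff₀ hV0]
        have h1 : 4 * K / ε ≤ V := by
          rw [hV, show 4 * K / ε = Real.sqrt ((4 * K / ε) ^ 2) by rw [Real.sqrt_sq (by positivity)]]
          exact Real.sqrt_le_sqrt (by linarith)
        have := mul_le_mul_of_nonneg_left h1 hε.le
        rw [mul_div_cancel₀ _ hε.ne'] at this
        linarith

/-- **The upper tail.** For `t ≥ 10` and a finite set `T` of zeros of `ζ` with `0 < Re ρ < 1` and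
`Im ρ > t + 1`, if `N(t+1) ≥ M(t+1) − Q` and `N(u) ≤ M(u) + (a log u + b log log u + c)` for all
`u ≥ t + 1` (`a, b, c, Q ≥ 0`), then
`Σ_{ρ ∈ T} m(ρ)/|1+it−ρ|² ≤ (1/2π)(1 + 1/t) log(t+1) + (a log(t+1) + b log log(t+1) + c) + Q + (a + b)/(t + 1)`
(partial summation of `(γ − t)^{-2}` against `N` on `(t+1, U]` and `U → ∞`, as in Ford's `I₁`).
[cite: Ford2002Millennium, Lemma 4.3 (proof: I₁)] -/
theorem upper_tail_sum_le {t a b c Q : ℝ} (ht : 10 ≤ t) (ha : 0 ≤ a) (hb : 0 ≤ b) (hc : 0 ≤ c)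
    (hQ : 0 ≤ Q) (T : Finset ℂ)
    (hT : ∀ ρ ∈ T, riemannZeta ρ = 0 ∧ 0 < ρ.re ∧ ρ.re < 1)
    (hW : ∀ ρ ∈ T, t + 1 < ρ.im)
    (hlo : rvmMain (t + 1) - Q ≤ (zetaZeroCount (t + 1) : ℝ))
    (hup : ∀ u : ℝ, t + 1 ≤ u →
      (zetaZeroCount u : ℝ) ≤ rvmMain u + (a * Real.log u + b * Real.log (Real.log u) + c)) :
    ∑ ρ ∈ T, (riemannZetaZeroOrder ρ : ℝ) / ‖1 + t * I - ρ‖ ^ 2 ≤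
      1 / (2 * π) * ((1 + 1 / t) * Real.log (t + 1))
        + (a * Real.log (t + 1) + b * Real.log (Real.log (t + 1)) + c) + Q + (a + b) / (t + 1) := by
  classical
  have hπ := Real.pi_pos
  set qf : ℝ → ℝ := fun u ↦ a * Real.log u + b * Real.log (Real.log u) + c with hqf
  set f : ℝ → ℝ := fun u ↦ 1 / (u - t) ^ 2 with hf
  set f' : ℝ → ℝ := fun u ↦ -2 / (u - t) ^ 3 with hf'
  set Ibound : ℝ := 1 / (2 * π) * ((1 + 1 / t) * Real.log (t + 1)) + qf (t + 1) + Q + (a + b) / (t + 1)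
    with hIb
  have hlog1 : 1 ≤ Real.log (t + 1) := by
    rw [Real.le_log_iff_exp_le (by linarith)]
    linarith [Real.exp_one_lt_d9]
  have hqf1 : 0 ≤ qf (t + 1) := by
    simp only [hqf]
    have : 0 ≤ Real.log (Real.log (t + 1)) := Real.log_nonneg hlog1
    positivity
  -- calculus of `f`
  have hfd : ∀ u, t < u → HasDerivAt f (f' u) u := by
    intro u hu
    have hne : u - t ≠ 0 := by linarith
    have h1 : HasDerivAt (fun v : ℝ ↦ (v - t) ^ 2) (((2 : ℕ) : ℝ) * (u - t) ^ (2 - 1) * 1) u :=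
      ((hasDerivAt_id' u).sub_const t).pow 2
    have h := (hasDerivAt_const u (1 : ℝ)).div h1 (pow_ne_zero 2 hne)
    refine h.congr_deriv ?_
    simp only [hf']
    field_simp
    ring
  have hf'cont : ContinuousOn f' (Ioi t) :=
    continuousOn_const.div ((continuousOn_id.sub continuousOn_const).pow 3) fun u hu ↦
      pow_ne_zero 3 (sub_ne_zero.2 (ne_of_gt (show t < u from hu)))
  have hm : ∀ ρ ∈ T, (0 : ℝ) ≤ riemannZetaZeroOrder ρ := fun ρ hρ ↦ by
    exact_mod_cast riemannZetaZeroOrder_nonneg fun h1 ↦ riemannZeta_one_ne_zero (h1 ▸ (hT ρ hρ).1)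
  have hqfc : ContinuousOn qf (Ici (t + 1)) := by
    have hl : ∀ u ∈ Ici (t + 1), Real.log u ≠ 0 := fun u hu ↦ by
      have : 1 < u := by linarith [mem_Ici.1 hu]
      exact (Real.log_pos this).ne'
    have hu0 : ∀ u ∈ Ici (t + 1), u ≠ 0 := fun u hu ↦ by linarith [mem_Ici.1 hu]
    exact ((continuousOn_const.mul (continuousOn_log.mono fun u hu ↦ hu0 u hu)).add
      (continuousOn_const.mul ((continuousOn_log.mono fun u hu ↦ hu0 u hu).log hl))).add
      continuousOn_const
  have hMc : ContinuousOn rvmMain (Ici (t + 1)) :=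
    continuousOn_rvmMain.mono fun u hu ↦ lt_of_lt_of_le (by linarith) (mem_Ici.1 hu)
  -- Step 1
  have hstep1 : ∀ U : ℝ, (∀ ρ ∈ T, ρ.im ≤ U) →
      ∑ ρ ∈ T, (riemannZetaZeroOrder ρ : ℝ) / ‖1 + t * I - ρ‖ ^ 2 ≤
        ∑ ρ ∈ zerosBetween (t + 1) U, (riemannZetaZeroOrder ρ : ℝ) * f ρ.im := by
    intro U hU
    have hTsub : T ⊆ zerosBetween (t + 1) U := by
      intro ρ hρ
      obtain ⟨hz, h0, h1⟩ := hT ρ hρ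
      rw [mem_zerosBetween (by linarith)]
      exact ⟨hz, h0.le, h1.le, hW ρ hρ, hU ρ hρ⟩
    have hmB : ∀ ρ ∈ zerosBetween (t + 1) U, (0 : ℝ) ≤ riemannZetaZeroOrder ρ := by
      intro ρ hρ
      rw [mem_zerosBetween (by linarith)] at hρ
      exact_mod_cast riemannZetaZeroOrder_nonneg fun h1 ↦ riemannZeta_one_ne_zero (h1 ▸ hρ.1)
    have h1 : ∀ ρ ∈ T, (riemannZetaZeroOrder ρ : ℝ) / ‖1 + t * I - ρ‖ ^ 2 ≤
        (riemannZetaZeroOrder ρ : ℝ) * f ρ.im := by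
      intro ρ hρ
      have him := Complex.abs_im_le_norm (1 + t * I - ρ)
      have e : (1 + t * I - ρ).im = t - ρ.im := by simp
      rw [e] at him
      have hpos : 0 < ρ.im - t := by linarith [hW ρ hρ]
      rw [abs_sub_comm, abs_of_pos hpos] at him
      simp only [hf, mul_one_div]
      apply div_le_div_of_nonneg_left (hm ρ hρ) (by positivity)
      exact pow_le_pow_left₀ hpos.le him 2
    calc _ ≤ ∑ ρ ∈ T, (riemannZetaZeroOrder ρ : ℝ) * f ρ.im := Finset.sum_le_sum h1
      _ ≤ _ := Finset.sum_le_sum_of_subset_of_nonneg hTsub fun ρ hρ _ ↦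
          mul_nonneg (hmB ρ hρ) (by simp only [hf]; positivity)
  -- Step 2
  have hstep2 : ∀ U : ℝ, t + 1 ≤ U →
      ∑ ρ ∈ zerosBetween (t + 1) U, (riemannZetaZeroOrder ρ : ℝ) * f ρ.im ≤
        (rvmMain U + qf U + (|rvmMain (t + 1)| + Q)) * f U + Ibound := by
    intro U hU
    have hIcc : Icc (t + 1) U ⊆ Ioi t := fun u hu ↦ show t < u by linarith [hu.1]
    have hps := sum_zerosBetween_le_of_count_le (T₁ := t + 1) (T₂ := U) (by linarith) hU
      (f := f) (f' := f') (Nup := fun u ↦ rvmMain u + qf u)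
      (fun u hu ↦ hfd u (by linarith [hu.1])) (hf'cont.mono hIcc)
      (fun u hu ↦ div_nonpos_of_nonpos_of_nonneg (by norm_num) (pow_nonneg (by linarith [hu.1]) 3))
      (by simp only [hf]; positivity)
      (fun u hu ↦ hup u hu.1) ((hMc.add hqfc).mono fun u hu ↦ mem_Ici.2 hu.1)
    refine hps.trans ?_
    have hfU : 0 ≤ f U := by simp only [hf]; positivity
    have hA : (rvmMain U + qf U - (zetaZeroCount (t + 1) : ℝ)) * f U ≤
        (rvmMain U + qf U + (|rvmMain (t + 1)| + Q)) * f U :=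
      mul_le_mul_of_nonneg_right (by linarith [neg_abs_le (rvmMain (t + 1))]) hfU
    have hqf_le : ∀ u, t + 1 ≤ u → qf u ≤ qf (t + 1) + (a + b) / (t + 1) * (u - t - 1) := by
      intro u hu
      simp only [hqf]
      have hl1 : Real.log (t + 1) ≤ Real.log u := Real.log_le_log (by linarith) hu
      have hu0 : 0 < u := by linarith
      have hdl : Real.log u - Real.log (t + 1) ≤ (u - t - 1) / (t + 1) := by
        have h := Real.log_le_sub_one_of_pos (show 0 < u / (t + 1) by positivity)
        rw [Real.log_div (by linarith) (by linarith)] at h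
        have e : u / (t + 1) - 1 = (u - t - 1) / (t + 1) := by field_simp; ring
        linarith
      have hdll : Real.log (Real.log u) - Real.log (Real.log (t + 1)) ≤ Real.log u - Real.log (t + 1) :=
        log_sub_log_le hlog1 hl1
      have e2 : (a + b) / (t + 1) * (u - t - 1) = (a + b) * ((u - t - 1) / (t + 1)) := by
        field_simp
      rw [e2]
      nlinarith [mul_le_mul_of_nonneg_left hdl ha, mul_le_mul_of_nonneg_left (hdll.trans hdl) hb]
    have h3c : ContinuousOn (fun u ↦ 2 / (u - t) ^ 3) (Icc (t + 1) U) :=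
      continuousOn_const.div ((continuousOn_id.sub continuousOn_const).pow 3) fun u hu ↦
        pow_ne_zero 3 (sub_ne_zero.2 (ne_of_gt (show t < u by linarith [hu.1])))
    have hlin : Continuous fun u : ℝ ↦ qf (t + 1) + Q + (a + b) / (t + 1) * (u - t - 1) := by
      fun_prop
    have hi1 : IntervalIntegrable (fun u ↦ (rvmMain u - rvmMain (t + 1)) * (2 / (u - t) ^ 3)) volume (t + 1) U :=
      (((hMc.mono fun u hu ↦ mem_Ici.2 hu.1).sub continuousOn_const).mul h3c).intervalIntegrable_of_Icc hU
    have hi2 : IntervalIntegrable (fun u ↦ (qf (t + 1) + Q + (a + b) / (t + 1) * (u - t - 1))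
        * (2 / (u - t) ^ 3)) volume (t + 1) U :=
      (hlin.continuousOn.mul h3c).intervalIntegrable_of_Icc hU
    have hmono : ∫ u in (t + 1)..U, (rvmMain u + qf u - (zetaZeroCount (t + 1) : ℝ)) * -f' u ≤
        ∫ u in (t + 1)..U, ((rvmMain u - rvmMain (t + 1)) * (2 / (u - t) ^ 3)
          + (qf (t + 1) + Q + (a + b) / (t + 1) * (u - t - 1)) * (2 / (u - t) ^ 3)) := by
      refine intervalIntegral.integral_mono_on hU ?_ (hi1.add hi2) fun u hu ↦ ?_
      · exact ((((hMc.add hqfc).mono fun u hu ↦ mem_Ici.2 hu.1).sub continuousOn_const).mul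
          (hf'cont.mono hIcc).neg).intervalIntegrable_of_Icc hU
      · have hpos : 0 < u - t := by linarith [hu.1]
        have hker : -f' u = 2 / (u - t) ^ 3 := by simp only [hf']; ring
        rw [hker, ← add_mul]
        apply mul_le_mul_of_nonneg_right _ (by positivity)
        linarith [hqf_le u hu.1, hlo]
    have hint : ∫ u in (t + 1)..U, (rvmMain u + qf u - (zetaZeroCount (t + 1) : ℝ)) * -f' u ≤ Ibound := by
      refine hmono.trans ?_
      rw [intervalIntegral.integral_add hi1 hi2]
      have hI1 := integral_rvm_parts_le ht hU
      have hI2 := integral_lin_le (t := t) (U := U) (K₀ := qf (t + 1) + Q) (κ := (a + b) / (t + 1))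
        (by linarith) (by positivity) hU
      rw [hIb]
      linarith
    linarith [hA, hint]
  -- Step 3: conclude with `U → ∞`
  refine le_of_forall_pos_le_add fun ε hε ↦ ?_
  obtain ⟨U, hU0, hUt, hAU⟩ := boundary_small (t := t) (a := a) (b := b) (c := c)
    (C := |rvmMain (t + 1)| + Q) (by linarith) ha hb hc (by positivity) hε (∑ ρ ∈ T, |ρ.im|)
  have hTU : ∀ ρ ∈ T, ρ.im ≤ U := by
    intro ρ hρ
    have h1 : |ρ.im| ≤ ∑ ρ ∈ T, |ρ.im| :=
      Finset.single_le_sum (f := fun ρ : ℂ ↦ |ρ.im|) (fun _ _ ↦ abs_nonneg _) hρ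
    linarith [le_abs_self ρ.im]
  have h1 := hstep1 U hTU
  have h2 := hstep2 U hUt
  have hAU' : (rvmMain U + qf U + (|rvmMain (t + 1)| + Q)) * f U ≤ ε := by
    simpa only [hqf, hf] using hAU
  linarith

/-! ## Negative ordinates (the conjugate zeros; Ford's `I₃`) -/

/-- **The zeros with `Im ρ < 0`.** For `t ≥ 10` and a finite set `T` of zeros of `ζ` with
`0 < Re ρ < 1` and `Im ρ < 0`, if `N(u) ≤ u log(u + 1) + 10` for all `u ≥ 0`, then
`Σ_{ρ ∈ T} m(ρ)/|1+it−ρ|² ≤ (3 log t + 2)/t + 20/t²` (conjugation `m(ρ̄) = m(ρ)` and partial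
summation of `(t + γ)^{-2}` against `N` on `(0, U]`). [cite: Ford2002Millennium, Lemma 4.3 (proof: I₃)] -/
theorem neg_ordinates_sum_le {t : ℝ} (ht : 10 ≤ t) (T : Finset ℂ)
    (hT : ∀ ρ ∈ T, riemannZeta ρ = 0 ∧ 0 < ρ.re ∧ ρ.re < 1)
    (hW : ∀ ρ ∈ T, ρ.im < 0)
    (hup : ∀ u : ℝ, 0 ≤ u → (zetaZeroCount u : ℝ) ≤ u * Real.log (u + 1) + 10) :
    ∑ ρ ∈ T, (riemannZetaZeroOrder ρ : ℝ) / ‖1 + t * I - ρ‖ ^ 2 ≤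
      (3 * Real.log t + 2) / t + 20 / t ^ 2 := by
  classical
  have ht0 : 0 < t := by linarith
  set g : ℝ → ℝ := fun u ↦ 1 / (t + u) ^ 2 with hg
  set g' : ℝ → ℝ := fun u ↦ -2 / (t + u) ^ 3 with hg'
  have hgd : ∀ u, 0 ≤ u → HasDerivAt g (g' u) u := by
    intro u hu
    have hne : t + u ≠ 0 := by linarith
    have h1 : HasDerivAt (fun v : ℝ ↦ (t + v) ^ 2) (((2 : ℕ) : ℝ) * (t + u) ^ (2 - 1) * 1) u :=
      ((hasDerivAt_id' u).const_add t).pow 2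
    have h := (hasDerivAt_const u (1 : ℝ)).div h1 (pow_ne_zero 2 hne)
    refine h.congr_deriv ?_
    simp only [hg']
    field_simp
    ring
  have hg'cont : ContinuousOn g' (Ici 0) :=
    continuousOn_const.div ((continuousOn_const.add continuousOn_id).pow 3) fun u hu ↦
      pow_ne_zero 3 (ne_of_gt (show 0 < t + u by linarith [mem_Ici.1 hu]))
  have hm : ∀ ρ ∈ T, (0 : ℝ) ≤ riemannZetaZeroOrder ρ := fun ρ hρ ↦ by
    exact_mod_cast riemannZetaZeroOrder_nonneg fun h1 ↦ riemannZeta_one_ne_zero (h1 ▸ (hT ρ hρ).1)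
  -- Step 1: pass to the conjugates
  set T' : Finset ℂ := T.image (starRingEnd ℂ) with hT'
  have hconj_mem : ∀ ρ ∈ T, riemannZeta (starRingEnd ℂ ρ) = 0 := fun ρ hρ ↦ by
    rw [riemannZeta_conj, (hT ρ hρ).1, map_zero]
  have hstep1 : ∀ U : ℝ, (∀ ρ ∈ T, -ρ.im ≤ U) →
      ∑ ρ ∈ T, (riemannZetaZeroOrder ρ : ℝ) / ‖1 + t * I - ρ‖ ^ 2 ≤
        ∑ ρ ∈ zerosBetween 0 U, (riemannZetaZeroOrder ρ : ℝ) * g ρ.im := by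
    intro U hU
    -- termwise: `m(ρ)/‖…‖² ≤ m(conj ρ) g(Im conj ρ)`
    have h1 : ∀ ρ ∈ T, (riemannZetaZeroOrder ρ : ℝ) / ‖1 + t * I - ρ‖ ^ 2 ≤
        (riemannZetaZeroOrder (starRingEnd ℂ ρ) : ℝ) * g (starRingEnd ℂ ρ).im := by
      intro ρ hρ
      rw [riemannZetaZeroOrder_conj_holds ρ, Complex.conj_im]
      have him := Complex.abs_im_le_norm (1 + t * I - ρ)
      have e : (1 + t * I - ρ).im = t - ρ.im := by simp
      rw [e] at him
      have hpos : 0 < t - ρ.im := by linarith [hW ρ hρ]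
      rw [abs_of_pos hpos] at him
      simp only [hg, mul_one_div, sub_eq_add_neg] at him ⊢
      apply div_le_div_of_nonneg_left (hm ρ hρ) (by positivity)
      exact pow_le_pow_left₀ (by linarith) him 2
    have h2 : ∑ ρ ∈ T, (riemannZetaZeroOrder (starRingEnd ℂ ρ) : ℝ) * g (starRingEnd ℂ ρ).im
        = ∑ ρ' ∈ T', (riemannZetaZeroOrder ρ' : ℝ) * g ρ'.im := by
      rw [hT', Finset.sum_image fun x _ y _ h ↦ (starRingEnd ℂ).injective h]
    have hT'sub : T' ⊆ zerosBetween 0 U := by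
      intro ρ' hρ'
      rw [hT', Finset.mem_image] at hρ'
      obtain ⟨ρ, hρ, rfl⟩ := hρ'
      obtain ⟨hz, h0, h1'⟩ := hT ρ hρ
      rw [mem_zerosBetween le_rfl, Complex.conj_re, Complex.conj_im]
      exact ⟨hconj_mem ρ hρ, h0.le, h1'.le, by linarith [hW ρ hρ], hU ρ hρ⟩
    have hmB : ∀ ρ ∈ zerosBetween 0 U, (0 : ℝ) ≤ riemannZetaZeroOrder ρ := by
      intro ρ hρ
      rw [mem_zerosBetween le_rfl] at hρ
      exact_mod_cast riemannZetaZeroOrder_nonneg fun h1 ↦ riemannZeta_one_ne_zero (h1 ▸ hρ.1)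
    calc _ ≤ ∑ ρ ∈ T, (riemannZetaZeroOrder (starRingEnd ℂ ρ) : ℝ) * g (starRingEnd ℂ ρ).im :=
          Finset.sum_le_sum h1
      _ = ∑ ρ' ∈ T', (riemannZetaZeroOrder ρ' : ℝ) * g ρ'.im := h2
      _ ≤ _ := Finset.sum_le_sum_of_subset_of_nonneg hT'sub fun ρ hρ _ ↦
          mul_nonneg (hmB ρ hρ) (by simp only [hg]; positivity)
  -- Step 2: partial summation on `(0, U]`, for `U ≥ 0`
  have hN0 : (zetaZeroCount 0 : ℝ) = 0 := by
    rw [zetaZeroCount_eq_zero_of_nonpos le_rfl]; simp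
  have hstep2 : ∀ U : ℝ, 0 ≤ U →
      ∑ ρ ∈ zerosBetween 0 U, (riemannZetaZeroOrder ρ : ℝ) * g ρ.im ≤
        (3 * Real.log t + 2) / t + 20 / t ^ 2 := by
    intro U hU
    set Nup : ℝ → ℝ := fun u ↦ u * Real.log (u + 1) + 10 with hNup
    have hNupc : ContinuousOn Nup (Icc 0 U) := by
      refine ((continuousOn_id.mul ((continuousOn_id.add continuousOn_const).log fun u hu ↦ ?_)).add
        continuousOn_const)
      have : (0 : ℝ) ≤ u := hu.1
      show id u + 1 ≠ 0
      simp only [id]; linarith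
    have hps := sum_zerosBetween_le_of_count_le (T₁ := 0) (T₂ := U) le_rfl hU
      (f := g) (f' := g') (Nup := Nup)
      (fun u hu ↦ hgd u hu.1) (hg'cont.mono fun u hu ↦ mem_Ici.2 hu.1)
      (fun u hu ↦ div_nonpos_of_nonpos_of_nonneg (by norm_num) (pow_nonneg (by linarith [hu.1]) 3))
      (by simp only [hg]; positivity)
      (fun u hu ↦ hup u hu.1) hNupc
    rw [hN0] at hps
    simp only [sub_zero] at hps
    refine hps.trans ?_
    -- boundary term: `Nup U * g U ≤ log t / t + 10/t²`
    have hlogtU : 0 ≤ Real.log (t + U) := Real.log_nonneg (by linarith)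
    have hUlog : U * Real.log (U + 1) ≤ (t + U) * Real.log (t + U) := by
      have h1 : Real.log (U + 1) ≤ Real.log (t + U) := Real.log_le_log (by linarith) (by linarith)
      have h2 : 0 ≤ Real.log (U + 1) := Real.log_nonneg (by linarith)
      nlinarith
    have hbd : Nup U * g U ≤ Real.log t / t + 10 / t ^ 2 := by
      simp only [hNup, hg]
      have htU : 0 < t + U := by linarith
      have h1 : (U * Real.log (U + 1) + 10) * (1 / (t + U) ^ 2)
          ≤ Real.log (t + U) / (t + U) + 10 / (t + U) ^ 2 := by
        have h1a : U * Real.log (U + 1) / (t + U) ^ 2 ≤ (t + U) * Real.log (t + U) / (t + U) ^ 2 :=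
          div_le_div_of_nonneg_right hUlog (by positivity)
        have h1b : (t + U) * Real.log (t + U) / (t + U) ^ 2 = Real.log (t + U) / (t + U) := by
          field_simp
        rw [add_mul, mul_one_div, mul_one_div]
        linarith [h1a, h1b]
      have h2 : Real.log (t + U) / (t + U) ≤ Real.log t / t := by
        have he : Real.exp 1 ≤ t := by linarith [Real.exp_one_lt_d9]
        exact Real.log_div_self_antitoneOn (mem_Ici.2 he) (mem_Ici.2 (by linarith)) (by linarith)
      have h3 : 10 / (t + U) ^ 2 ≤ 10 / t ^ 2 := by
        apply div_le_div_of_nonneg_left (by norm_num) (by positivity)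
        nlinarith
      linarith
    -- the integral: majorant `2 log(t+u)/(t+u)² + 20/(t+u)³`
    have hint : ∫ u in (0 : ℝ)..U, Nup u * -g' u ≤ 2 * ((Real.log t + 1) / t) + 10 / t ^ 2 := by
      have hmaj : ∀ u ∈ Icc 0 U, Nup u * -g' u ≤
          2 * (Real.log (t + u) / (t + u) ^ 2) + 20 / (t + u) ^ 3 := by
        intro u hu
        simp only [hNup, hg']
        have htu : 0 < t + u := by linarith [hu.1]
        have hul : u * Real.log (u + 1) ≤ (t + u) * Real.log (t + u) := by
          have h1 : Real.log (u + 1) ≤ Real.log (t + u) := Real.log_le_log (by linarith [hu.1]) (by linarith)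
          have h2 : 0 ≤ Real.log (u + 1) := Real.log_nonneg (by linarith [hu.1])
          nlinarith [hu.1]
        have e : (u * Real.log (u + 1) + 10) * -(-2 / (t + u) ^ 3)
            = 2 * (u * Real.log (u + 1)) / (t + u) ^ 3 + 20 / (t + u) ^ 3 := by ring
        rw [e]
        have h3 : 2 * (u * Real.log (u + 1)) / (t + u) ^ 3 ≤ 2 * (Real.log (t + u) / (t + u) ^ 2) := by
          rw [div_le_iff₀ (by positivity)]
          have e2 : 2 * (Real.log (t + u) / (t + u) ^ 2) * (t + u) ^ 3 = 2 * ((t + u) * Real.log (t + u)) := by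
            field_simp
          rw [e2]
          linarith
        linarith
      have hFd : ∀ u ∈ Set.uIcc 0 U, HasDerivAt
          (fun v ↦ -2 * ((Real.log (t + v) + 1) / (t + v)) - 10 / (t + v) ^ 2)
          (2 * (Real.log (t + u) / (t + u) ^ 2) + 20 / (t + u) ^ 3) u := by
        intro u hu
        rw [Set.uIcc_of_le hU] at hu
        have htu : 0 < t + u := by linarith [hu.1]
        have hne : t + u ≠ 0 := htu.ne'
        have hl : HasDerivAt (fun v ↦ Real.log (t + v) + 1) ((t + u)⁻¹ * 1) u := by
          simpa using (((hasDerivAt_id' u).const_add t).log hne).add_const 1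
        have hA := (hl.div ((hasDerivAt_id' u).const_add t) hne).const_mul (-2)
        have hp2 : HasDerivAt (fun v : ℝ ↦ (t + v) ^ 2) (((2 : ℕ) : ℝ) * (t + u) ^ (2 - 1) * 1) u :=
          ((hasDerivAt_id' u).const_add t).pow 2
        have hB := (hasDerivAt_const u (10 : ℝ)).div hp2 (pow_ne_zero 2 hne)
        refine (hA.sub hB).congr_deriv ?_
        field_simp
        ring
      have hmc : ContinuousOn (fun u ↦ 2 * (Real.log (t + u) / (t + u) ^ 2) + 20 / (t + u) ^ 3) (Icc 0 U) := by
        have hne : ∀ u ∈ Icc 0 U, t + u ≠ 0 := fun u hu ↦ by linarith [hu.1]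
        refine (continuousOn_const.mul (((continuousOn_const.add continuousOn_id).log hne).div
          ((continuousOn_const.add continuousOn_id).pow 2) fun u hu ↦ pow_ne_zero 2 (hne u hu))).add
          (continuousOn_const.div ((continuousOn_const.add continuousOn_id).pow 3) fun u hu ↦
            pow_ne_zero 3 (hne u hu))
      have hmono : ∫ u in (0 : ℝ)..U, Nup u * -g' u ≤
          ∫ u in (0 : ℝ)..U, (2 * (Real.log (t + u) / (t + u) ^ 2) + 20 / (t + u) ^ 3) := by
        refine intervalIntegral.integral_mono_on hU ?_ (hmc.intervalIntegrable_of_Icc hU) hmaj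
        exact (hNupc.mul (hg'cont.mono fun u hu ↦ mem_Ici.2 hu.1).neg).intervalIntegrable_of_Icc hU
      refine hmono.trans ?_
      rw [intervalIntegral.integral_eq_sub_of_hasDerivAt hFd ((hmc.mono (by rw [Set.uIcc_of_le hU])).intervalIntegrable)]
      have htU : 0 < t + U := by linarith
      have h1 : 0 ≤ (Real.log (t + U) + 1) / (t + U) := by positivity
      have h2 : 0 ≤ 10 / (t + U) ^ 2 := by positivity
      simp only [add_zero]
      have e : -2 * ((Real.log t + 1) / t) - 10 / t ^ 2 = -(2 * ((Real.log t + 1) / t) + 10 / t ^ 2) := by ring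
      rw [e]
      linarith
    have e3 : (3 * Real.log t + 2) / t + 20 / t ^ 2
        = (Real.log t / t + 10 / t ^ 2) + (2 * ((Real.log t + 1) / t) + 10 / t ^ 2) := by
      field_simp; ring
    rw [e3]
    exact add_le_add hbd hint
  -- conclude
  set U : ℝ := ∑ ρ ∈ T, |ρ.im| with hUdef
  have hU0 : 0 ≤ U := Finset.sum_nonneg fun _ _ ↦ abs_nonneg _
  have hTU : ∀ ρ ∈ T, -ρ.im ≤ U := by
    intro ρ hρ
    have h1 : |ρ.im| ≤ U := Finset.single_le_sum (f := fun ρ : ℂ ↦ |ρ.im|) (fun _ _ ↦ abs_nonneg _) hρ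
    linarith [neg_abs_le ρ.im, neg_le_abs ρ.im]
  exact (hstep1 U hTU).trans (hstep2 U hU0)

/-! ## The inputs from the Riemann–von Mangoldt formula (3.8) (Hasanalizade–Shen–Wong) -/

/-- The error bound `q(u) = 0.1038 log u + 0.2573 log log u + 9.3675` of (3.8).
[cite: MossinghoffTrudgianYangRNT2024, (3.8)] -/
def hswErr (u : ℝ) : ℝ := 0.1038 * Real.log u + 0.2573 * Real.log (Real.log u) + 9.3675

/-- (3.8) unpacked: `M(u) − q(u) ≤ N(u) ≤ M(u) + q(u)` for `u ≥ e`. [cite: MossinghoffTrudgianYangRNT2024, (3.8)] -/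
theorem hsw_bounds (h : zetaZeroCount_hasanalizade_shen_wong) {u : ℝ} (hu : Real.exp 1 ≤ u) :
    rvmMain u - hswErr u ≤ (zetaZeroCount u : ℝ) ∧ (zetaZeroCount u : ℝ) ≤ rvmMain u + hswErr u := by
  have h1 := h u hu
  rw [abs_le] at h1
  unfold rvmMain hswErr
  constructor <;> linarith [h1.1, h1.2]

/-- `q ≥ 0` and `q` is monotone on `[e, ∞)`. [folklore] -/
theorem hswErr_mono {u v : ℝ} (hu : Real.exp 1 ≤ u) (huv : u ≤ v) : hswErr u ≤ hswErr v := by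
  unfold hswErr
  have hu0 : 0 < u := (Real.exp_pos 1).trans_le hu
  have hl : 1 ≤ Real.log u := by rwa [Real.le_log_iff_exp_le hu0]
  have h1 : Real.log u ≤ Real.log v := Real.log_le_log hu0 huv
  have h2 : Real.log (Real.log u) ≤ Real.log (Real.log v) := Real.log_le_log (by linarith) h1
  linarith

/-- `q(u) ≥ 0` for `u ≥ e`. [folklore] -/
theorem hswErr_nonneg {u : ℝ} (hu : Real.exp 1 ≤ u) : 0 ≤ hswErr u := by
  unfold hswErr
  have hu0 : 0 < u := (Real.exp_pos 1).trans_le hu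
  have hl : 1 ≤ Real.log u := by rwa [Real.le_log_iff_exp_le hu0]
  have : 0 ≤ Real.log (Real.log u) := Real.log_nonneg hl
  positivity

/-- A crude consequence of (3.8): `N(u) ≤ u log(u + 1) + 10` for all `u ≥ 0`. [folklore] -/
theorem count_le_crude (h : zetaZeroCount_hasanalizade_shen_wong) {u : ℝ} (hu : 0 ≤ u) :
    (zetaZeroCount u : ℝ) ≤ u * Real.log (u + 1) + 10 := by
  have hπ3 := Real.pi_gt_three
  have he := Real.exp_pos (1 : ℝ)
  have he1 : Real.exp 1 < 3 := lt_trans Real.exp_one_lt_d9 (by norm_num)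
  -- at `u = e`: `N(e) ≤ M(e) + q(e) ≤ 0 + 9.3675 + 0.1038`
  have hqe : hswErr (Real.exp 1) ≤ 9.4713 := by
    unfold hswErr
    rw [Real.log_exp, Real.log_one]
    norm_num
  have hNe : (zetaZeroCount (Real.exp 1) : ℝ) ≤ 9.4713 := by
    have := (hsw_bounds h le_rfl).2
    linarith [rvmMain_exp_one_nonpos]
  rcases le_or_gt u (Real.exp 1) with hue | hue
  · have hmono : (zetaZeroCount u : ℝ) ≤ zetaZeroCount (Real.exp 1) := by
      exact_mod_cast zetaZeroCount_mono hue
    have : 0 ≤ u * Real.log (u + 1) := mul_nonneg hu (Real.log_nonneg (by linarith))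
    linarith
  · have hb := (hsw_bounds h hue.le).2
    have hu0 : 0 < u := he.trans hue
    have hu1 : 1 ≤ Real.log u := by rw [Real.le_log_iff_exp_le (by linarith)]; exact hue.le
    have hl1 : Real.log u ≤ Real.log (u + 1) := Real.log_le_log (by linarith) (by linarith)
    have hll : Real.log (Real.log u) ≤ Real.log u := by
      have := Real.log_le_sub_one_of_pos (show 0 < Real.log u by linarith)
      linarith
    -- `M(u) ≤ (u/2π) log(u+1)`, `q(u) ≤ 0.3611 log(u+1) + 9.3675 ≤ 0.3611 u log(u+1)/e + 9.3675`
    have hM : rvmMain u ≤ u / (2 * π) * Real.log (u + 1) := by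
      unfold rvmMain
      apply mul_le_mul_of_nonneg_left _ (by positivity)
      apply Real.log_le_log (by positivity)
      rw [div_le_iff₀ (by positivity)]
      have : 1 ≤ 2 * π * Real.exp 1 := by nlinarith [Real.add_one_le_exp (1 : ℝ)]
      nlinarith
    have hq : hswErr u ≤ 0.3611 * Real.log (u + 1) + 9.3675 := by
      unfold hswErr; linarith
    have hlu : Real.log (u + 1) ≤ u * Real.log (u + 1) / Real.exp 1 := by
      rw [le_div_iff₀ he]
      have : 0 ≤ Real.log (u + 1) := by linarith
      nlinarith [mul_le_mul_of_nonneg_right hue.le this]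
    have h3 : u / (2 * π) ≤ 0.17 * u := by
      rw [div_le_iff₀ (by positivity)]; nlinarith
    have hl0 : 0 ≤ Real.log (u + 1) := by linarith
    have h4 : 0 ≤ u * Real.log (u + 1) := mul_nonneg hu0.le hl0
    have h5 : u / (2 * π) * Real.log (u + 1) ≤ 0.17 * (u * Real.log (u + 1)) := by
      have := mul_le_mul_of_nonneg_right h3 hl0
      linarith
    have h6 : 0.3611 * Real.log (u + 1) ≤ 0.3611 * (u * Real.log (u + 1) / Real.exp 1) := by
      exact mul_le_mul_of_nonneg_left hlu (by norm_num)
    have h7 : u * Real.log (u + 1) / Real.exp 1 ≤ u * Real.log (u + 1) / 2.7 := by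
      apply div_le_div_of_nonneg_left h4 (by norm_num)
      linarith [Real.exp_one_gt_d9]
    set X : ℝ := u * Real.log (u + 1) with hX
    have h8 : hswErr u ≤ 0.3611 * (X / 2.7) + 9.3675 := by
      have : 0.3611 * (X / Real.exp 1) ≤ 0.3611 * (X / 2.7) := mul_le_mul_of_nonneg_left h7 (by norm_num)
      linarith [hq, h6, this]
    have h9 : (zetaZeroCount u : ℝ) ≤ 0.17 * X + (0.3611 * (X / 2.7) + 9.3675) := by linarith [hb, hM, h5, h8]
    have h10 : 0.17 * X + (0.3611 * (X / 2.7) + 9.3675) ≤ X + 10 := by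
      have : 0.3611 * (X / 2.7) ≤ 0.134 * X := by
        rw [show 0.3611 * (X / 2.7) = (0.3611 / 2.7) * X by ring]
        exact mul_le_mul_of_nonneg_right (by norm_num) h4
      linarith
    linarith

/-- The window count from (3.8): `N(t+1) − N(t−1) ≤ (1/π) log((t+1)/(2π)) + q(t+1) + q(t−1)`
(`t ≥ 10`; mean value theorem for `M`). [folklore] -/
theorem window_count_le (h : zetaZeroCount_hasanalizade_shen_wong) {t : ℝ} (ht : 10 ≤ t) :
    (zetaZeroCount (t + 1) : ℝ) - zetaZeroCount (t - 1) ≤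
      1 / π * Real.log ((t + 1) / (2 * π)) + hswErr (t + 1) + hswErr (t - 1) := by
  have hπ := Real.pi_pos
  have hπ3 := Real.pi_gt_three
  have he1 : Real.exp 1 < 3 := lt_trans Real.exp_one_lt_d9 (by norm_num)
  have h1 := (hsw_bounds h (show Real.exp 1 ≤ t + 1 by linarith)).2
  have h2 := (hsw_bounds h (show Real.exp 1 ≤ t - 1 by linarith)).1
  -- MVT: `M(t+1) − M(t−1) = 2 M'(ξ) ≤ 2 M'(t+1)`
  have hMVT : rvmMain (t + 1) - rvmMain (t - 1) ≤ 1 / π * Real.log ((t + 1) / (2 * π)) := by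
    have hcont : ContinuousOn rvmMain (Icc (t - 1) (t + 1)) :=
      continuousOn_rvmMain.mono fun u hu ↦ show (0 : ℝ) < u by linarith [hu.1]
    have hdiff : ∀ u ∈ Ioo (t - 1) (t + 1), HasDerivAt rvmMain (1 / (2 * π) * Real.log (u / (2 * π))) u :=
      fun u hu ↦ hasDerivAt_rvmMain (by linarith [hu.1])
    obtain ⟨ξ, hξ, hξeq⟩ := exists_hasDerivAt_eq_slope rvmMain (fun u ↦ 1 / (2 * π) * Real.log (u / (2 * π)))
      (by linarith) hcont hdiff
    have hξ0 : 0 < ξ := by linarith [hξ.1]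
    have hlog : Real.log (ξ / (2 * π)) ≤ Real.log ((t + 1) / (2 * π)) :=
      Real.log_le_log (by positivity) (by rw [div_le_div_iff_of_pos_right (by positivity)]; linarith [hξ.2])
    have e : t + 1 - (t - 1) = 2 := by ring
    rw [e, eq_div_iff (by norm_num)] at hξeq
    have : rvmMain (t + 1) - rvmMain (t - 1) = 2 * (1 / (2 * π) * Real.log (ξ / (2 * π))) := by linarith
    rw [this]
    have e2 : 2 * (1 / (2 * π) * Real.log (ξ / (2 * π))) = 1 / π * Real.log (ξ / (2 * π)) := by
      field_simp
    rw [e2]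
    exact mul_le_mul_of_nonneg_left hlog (by positivity)
  linarith

/-! ## Assembly: (6.4) = Ford (9.2) for `t ≥ e²⁴⁰` from (3.8) -/

/-- `t ≥ e²⁴⁰` gives `t ≥ 4.9·10⁷`, `√t ≥ 7000`, `log t ≥ 240`, `log log t ≥ 5.47`. [folklore] -/
theorem basics_of_exp240_le {t : ℝ} (ht : Real.exp 240 ≤ t) :
    49000000 ≤ t ∧ 7000 ≤ Real.sqrt t ∧ 240 ≤ Real.log t ∧ 5.47 ≤ Real.log (Real.log t) := by
  have he := Real.exp_one_gt_d9
  have h18 : (49000000 : ℝ) ≤ Real.exp 18 := by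
    have : Real.exp 18 = Real.exp 1 ^ 18 := by rw [← Real.exp_nat_mul]; norm_num
    rw [this]
    calc (49000000 : ℝ) ≤ 2.7182818283 ^ 18 := by norm_num
      _ ≤ Real.exp 1 ^ 18 := pow_le_pow_left₀ (by norm_num) he.le 18
  have ht1 : (49000000 : ℝ) ≤ t := h18.trans ((Real.exp_le_exp.2 (by norm_num)).trans ht)
  have ht0 : 0 < t := by linarith
  have hsqrt : 7000 ≤ Real.sqrt t := by
    rw [show (7000 : ℝ) = Real.sqrt (7000 ^ 2) by rw [Real.sqrt_sq (by norm_num)]]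
    exact Real.sqrt_le_sqrt (by nlinarith)
  have hL : 240 ≤ Real.log t := by
    rw [Real.le_log_iff_exp_le ht0]; exact ht
  have hLL : 5.47 ≤ Real.log (Real.log t) := by
    rw [Real.le_log_iff_exp_le (by linarith)]
    have h : Real.exp ((5 : ℕ) + 0.47) ≤ 240 :=
      VK.exp_le_of_expUB_le (k := 5) (f := 0.47) (by norm_num) (by norm_num) (by norm_num [VK.expUB])
    norm_num at h
    linarith
  exact ⟨ht1, hsqrt, hL, hLL⟩

/-- `log(x/(2π)) ≤ log x` for `x > 0`. [folklore] -/
theorem log_div_two_pi_le {x : ℝ} (hx : 0 < x) : Real.log (x / (2 * π)) ≤ Real.log x := by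
  have hπ3 := Real.pi_gt_three
  apply Real.log_le_log (by positivity)
  rw [div_le_iff₀ (by positivity)]
  nlinarith

/-- `1/π ≤ 0.3184` and `1/(2π) ≤ 0.15916`. [folklore] -/
theorem inv_pi_bounds : 1 / π ≤ 0.3184 ∧ 1 / (2 * π) ≤ 0.15916 := by
  have hπ := Real.pi_pos
  have hπ3 := Real.pi_gt_d6
  constructor
  · rw [div_le_iff₀ hπ]; linarith
  · rw [div_le_iff₀ (by positivity)]; linarith

/-- For `√t ≥ 7000` (and `t ≥ 4.9·10⁷`): `(3 log t + 2)/t + 20/t² ≤ 0.002`. [folklore] -/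
theorem neg_bound_small {t : ℝ} (ht1 : 49000000 ≤ t) (hsqrt : 7000 ≤ Real.sqrt t) :
    (3 * Real.log t + 2) / t + 20 / t ^ 2 ≤ 0.002 := by
  have ht0 : 0 < t := by linarith
  have hs := Real.mul_self_sqrt ht0.le
  have hlogsq : Real.log t ≤ 2 * Real.sqrt t := log_le_two_sqrt ht0
  have h1 : (3 * Real.log t + 2) / t ≤ 0.001 := by
    rw [div_le_iff₀ ht0]
    nlinarith [hsqrt, hs, hlogsq]
  have h2 : 20 / t ^ 2 ≤ 0.001 := by
    rw [div_le_iff₀ (by positivity)]; nlinarith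
  linarith

/-- Elementary bounds at a height `t ≥ e²⁴⁰` (`L = log t`): `1/t ≤ 0.001`, `log(t+1) ≤ L + 1/t`,
`log log(t+1) ≤ log L + 1/t`, `q(t+1) ≤ 0.1038(L + 0.001) + 0.2573(log L + 0.001) + 9.3675`,
`q(t−1) ≤ 0.1038 L + 0.2573 log L + 9.3675`, `log((t+1)/2π) ≤ L + 0.001`, `log(t/2π) ≤ L`.
[folklore] -/
theorem height_bounds {t : ℝ} (ht : Real.exp 240 ≤ t) :
    1 / t ≤ 0.001 ∧ Real.log (t + 1) ≤ Real.log t + 1 / t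
      ∧ Real.log (Real.log (t + 1)) ≤ Real.log (Real.log t) + 1 / t
      ∧ hswErr (t + 1) ≤ 0.1038 * (Real.log t + 0.001) + 0.2573 * (Real.log (Real.log t) + 0.001) + 9.3675
      ∧ hswErr (t - 1) ≤ 0.1038 * Real.log t + 0.2573 * Real.log (Real.log t) + 9.3675
      ∧ Real.log ((t + 1) / (2 * π)) ≤ Real.log t + 0.001
      ∧ Real.log (t / (2 * π)) ≤ Real.log t := by
  obtain ⟨ht1, -, hL, -⟩ := basics_of_exp240_le ht
  have he1 : Real.exp 1 < 3 := lt_trans Real.exp_one_lt_d9 (by norm_num)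
  have ht0 : 0 < t := by linarith
  set L : ℝ := Real.log t with hLdef
  have hinv : 1 / t ≤ 0.001 := by
    rw [div_le_iff₀ ht0]; linarith
  have hlog1 : Real.log (t + 1) ≤ L + 1 / t := by
    have hh := Real.log_le_sub_one_of_pos (show 0 < (t + 1) / t by positivity)
    rw [Real.log_div (by linarith) ht0.ne'] at hh
    have e : (t + 1) / t - 1 = 1 / t := by field_simp; ring
    linarith
  have hL1 : 1 ≤ L := by linarith
  have hloglog1 : Real.log (Real.log (t + 1)) ≤ Real.log L + 1 / t := by
    have h1 : L ≤ Real.log (t + 1) := Real.log_le_log ht0 (by linarith)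
    have h2 := log_sub_log_le hL1 h1
    linarith
  have hq1 : hswErr (t + 1) ≤ 0.1038 * (L + 0.001) + 0.2573 * (Real.log L + 0.001) + 9.3675 := by
    unfold hswErr
    have h1 : 0.1038 * Real.log (t + 1) ≤ 0.1038 * (L + 0.001) :=
      mul_le_mul_of_nonneg_left (by linarith) (by norm_num)
    have h2 : 0.2573 * Real.log (Real.log (t + 1)) ≤ 0.2573 * (Real.log L + 0.001) :=
      mul_le_mul_of_nonneg_left (by linarith) (by norm_num)
    linarith
  have hqm1 : hswErr (t - 1) ≤ 0.1038 * L + 0.2573 * Real.log L + 9.3675 := by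
    have := hswErr_mono (show Real.exp 1 ≤ t - 1 by linarith) (show t - 1 ≤ t by linarith)
    unfold hswErr at this ⊢
    linarith
  have hlog2π : Real.log ((t + 1) / (2 * π)) ≤ L + 0.001 := by
    have := log_div_two_pi_le (show 0 < t + 1 by linarith)
    linarith
  have hlogt2π : Real.log (t / (2 * π)) ≤ L := log_div_two_pi_le ht0
  exact ⟨hinv, hlog1, hloglog1, hq1, hqm1, hlog2π, hlogt2π⟩

/-- **The far-zero bound (6.4) of Mossinghoff–Trudgian–Yang = Ford 2002, (9.2), for `t ≥ e²⁴⁰`,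
from the Riemann–von Mangoldt formula (3.8)** (Hasanalizade–Shen–Wong, the tree's named fact
`zetaZeroCount_hasanalizade_shen_wong`): for every finite set `T` of non-trivial zeros of `ζ`
strictly outside the disc `|1 + it − ρ| ≤ ½`,
`Σ_{ρ ∈ T} m(ρ)/|1+it−ρ|² ≤ 3.2357 log t + 5.316 log log t + 16.134 − 4N(t, ½)`.
Ford derives (9.2) for `t ≥ 10⁴` from Rosser's `N(T)` theorem ("as in the proof of Lemma 4.3":
the zeros with `|γ − t| ≥ 1` by Stieltjes integration against `N`, the window `|γ − t| < 1` by
counting); with (3.8), whose constant `9.3675` is larger than Rosser's `1.588`, the same partition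
(`upper_tail_sum_le`, `lower_tail_sum_le`, `neg_ordinates_sum_le`, `window_sum_le`) gives
`2.838 log t + 3.088 log log t + 112.5 − 4N(t, ½)`, which is below Ford's expression once
`log t ≥ 240`. The far sum is over `|1 + it − ρ| > ½` (STRICT): the window count subtracts the
closed-disc count `N(t, ½)`, so zeros on the circle must not be in `T`.
[cite: Ford2002Millennium, (9.2)] [cite: MossinghoffTrudgianYangRNT2024, (6.4) and (3.8)] -/
theorem farZeroSum_half_of_hsw (h : zetaZeroCount_hasanalizade_shen_wong) {t : ℝ}
    (ht : Real.exp 240 ≤ t) (T : Finset ℂ)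
    (hT : ∀ ρ ∈ T, riemannZeta ρ = 0 ∧ 0 < ρ.re ∧ ρ.re < 1 ∧ 1 / 2 < ‖1 + t * I - ρ‖) :
    ∑ ρ ∈ T, (riemannZetaZeroOrder ρ : ℝ) / ‖1 + t * I - ρ‖ ^ 2 ≤
      3.2357 * Real.log t + 5.316 * Real.log (Real.log t) + 16.134 - 4 * fordN t (1 / 2) := by
  classical
  obtain ⟨ht1, hsqrt, hL, hLL⟩ := basics_of_exp240_le ht
  have hπ := Real.pi_pos
  have hπ3 := Real.pi_gt_d6
  have hπ4 := Real.pi_lt_d2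
  have he1 : Real.exp 1 < 3 := lt_trans Real.exp_one_lt_d9 (by norm_num)
  have ht10 : (10 : ℝ) ≤ t := by linarith
  have ht0 : 0 < t := by linarith
  set L : ℝ := Real.log t with hLdef
  set F : ℂ → ℝ := fun ρ ↦ (riemannZetaZeroOrder ρ : ℝ) / ‖1 + t * I - ρ‖ ^ 2 with hF
  -- no zero has `Im ρ = 0`
  have him0 : ∀ ρ ∈ T, ρ.im ≠ 0 := by
    intro ρ hρ h0
    obtain ⟨hz, h0', h1', -⟩ := hT ρ hρ
    exact riemannZeta_ne_zero_of_im_eq_zero_of_pos_of_lt_one h0 h0' h1' hz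
  -- the partition
  set T1 := T.filter fun ρ ↦ t + 1 < ρ.im with hT1
  set R1 := T.filter fun ρ ↦ ¬ (t + 1 < ρ.im) with hR1
  set T4 := R1.filter fun ρ ↦ t - 1 < ρ.im with hT4
  set R2 := R1.filter fun ρ ↦ ¬ (t - 1 < ρ.im) with hR2
  set T2 := R2.filter fun ρ ↦ 0 < ρ.im with hT2
  set T3 := R2.filter fun ρ ↦ ¬ (0 < ρ.im) with hT3
  have hsplit : ∑ ρ ∈ T, F ρ = ∑ ρ ∈ T1, F ρ + ∑ ρ ∈ T4, F ρ + ∑ ρ ∈ T2, F ρ + ∑ ρ ∈ T3, F ρ := by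
    rw [← Finset.sum_filter_add_sum_filter_not T (fun ρ ↦ t + 1 < ρ.im) F, ← hT1, ← hR1,
      ← Finset.sum_filter_add_sum_filter_not R1 (fun ρ ↦ t - 1 < ρ.im) F, ← hT4, ← hR2,
      ← Finset.sum_filter_add_sum_filter_not R2 (fun ρ ↦ 0 < ρ.im) F, ← hT2, ← hT3]
    ring
  -- membership facts
  have hbase : ∀ S : Finset ℂ, S ⊆ T → ∀ ρ ∈ S, riemannZeta ρ = 0 ∧ 0 < ρ.re ∧ ρ.re < 1 :=
    fun S hS ρ hρ ↦ ⟨(hT ρ (hS hρ)).1, (hT ρ (hS hρ)).2.1, (hT ρ (hS hρ)).2.2.1⟩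
  have hT1sub : T1 ⊆ T := Finset.filter_subset _ _
  have hR1sub : R1 ⊆ T := Finset.filter_subset _ _
  have hT4sub : T4 ⊆ T := (Finset.filter_subset _ _).trans hR1sub
  have hR2sub : R2 ⊆ T := (Finset.filter_subset _ _).trans hR1sub
  have hT2sub : T2 ⊆ T := (Finset.filter_subset _ _).trans hR2sub
  have hT3sub : T3 ⊆ T := (Finset.filter_subset _ _).trans hR2sub
  have hW1 : ∀ ρ ∈ T1, t + 1 < ρ.im := fun ρ hρ ↦ (Finset.mem_filter.1 hρ).2
  have hW4 : ∀ ρ ∈ T4, t - 1 < ρ.im ∧ ρ.im ≤ t + 1 := fun ρ hρ ↦ by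
    have h4 := Finset.mem_filter.1 hρ
    have hr1 := Finset.mem_filter.1 h4.1
    exact ⟨h4.2, not_lt.1 hr1.2⟩
  have hW2 : ∀ ρ ∈ T2, 0 < ρ.im ∧ ρ.im ≤ t - 1 := fun ρ hρ ↦ by
    have h2 := Finset.mem_filter.1 hρ
    have hr2 := Finset.mem_filter.1 h2.1
    exact ⟨h2.2, not_lt.1 hr2.2⟩
  have hW3 : ∀ ρ ∈ T3, ρ.im < 0 := fun ρ hρ ↦ by
    have h3 := Finset.mem_filter.1 hρ
    have hle : ρ.im ≤ 0 := not_lt.1 h3.2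
    exact lt_of_le_of_ne hle (him0 ρ (hT3sub hρ))
  -- (3.8) at the relevant points
  have hbt1 := hsw_bounds h (show Real.exp 1 ≤ t + 1 by linarith)
  have hbtm1 := hsw_bounds h (show Real.exp 1 ≤ t - 1 by linarith)
  -- the four bounds
  have hS1 : ∑ ρ ∈ T1, F ρ ≤ 1 / (2 * π) * ((1 + 1 / t) * Real.log (t + 1))
      + (0.1038 * Real.log (t + 1) + 0.2573 * Real.log (Real.log (t + 1)) + 9.3675)
      + hswErr (t + 1) + (0.1038 + 0.2573) / (t + 1) := by
    refine upper_tail_sum_le ht10 (by norm_num) (by norm_num) (by norm_num) (hswErr_nonneg (by linarith))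
      T1 (hbase T1 hT1sub) hW1 hbt1.1 fun u hu ↦ ?_
    exact (hsw_bounds h (show Real.exp 1 ≤ u by linarith)).2
  have hS2 : ∑ ρ ∈ T2, F ρ ≤ 2 * hswErr (t - 1) + 1 / (2 * π) * Real.log (t / (2 * π)) := by
    refine lower_tail_sum_le ht10 (hswErr_nonneg (by linarith)) T2 (hbase T2 hT2sub) hW2
      (fun u hu ↦ ?_) hbtm1.2
    have hb := (hsw_bounds h hu.1).1
    have hm := hswErr_mono hu.1 hu.2
    linarith
  have hS3 : ∑ ρ ∈ T3, F ρ ≤ (3 * Real.log t + 2) / t + 20 / t ^ 2 :=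
    neg_ordinates_sum_le ht10 T3 (hbase T3 hT3sub) hW3 fun u hu ↦ count_le_crude h hu
  have hS4 : ∑ ρ ∈ T4, F ρ ≤ 4 * ((zetaZeroCount (t + 1) : ℝ) - zetaZeroCount (t - 1) - fordN t (1 / 2)) :=
    window_sum_le (by linarith) T4 (fun ρ hρ ↦ hT ρ (hT4sub hρ)) hW4
  have hWin := window_count_le h ht10
  -- elementary bounds at height `t`
  obtain ⟨hinv, hlog1, hloglog1, hq1, hqm1, hlog2π, hlogt2π⟩ := height_bounds ht
  obtain ⟨hinvπ, hinv2π⟩ := inv_pi_bounds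
  have hS3' := neg_bound_small ht1 hsqrt
  -- main terms of `S1`
  have hS1a : 1 / (2 * π) * ((1 + 1 / t) * Real.log (t + 1)) ≤ 0.15916 * (1.001 * (L + 0.001)) := by
    have h1 : (1 + 1 / t) * Real.log (t + 1) ≤ 1.001 * (L + 0.001) := by
      have hlpos : 0 ≤ Real.log (t + 1) := Real.log_nonneg (by linarith)
      calc (1 + 1 / t) * Real.log (t + 1) ≤ 1.001 * Real.log (t + 1) :=
            mul_le_mul_of_nonneg_right (by linarith) hlpos
        _ ≤ 1.001 * (L + 0.001) := mul_le_mul_of_nonneg_left (by linarith) (by norm_num)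
    have h0 : 0 ≤ (1 + 1 / t) * Real.log (t + 1) := by
      have : 0 ≤ 1 / t := by positivity
      exact mul_nonneg (by linarith) (Real.log_nonneg (by linarith))
    calc _ ≤ 0.15916 * ((1 + 1 / t) * Real.log (t + 1)) := mul_le_mul_of_nonneg_right hinv2π h0
      _ ≤ _ := mul_le_mul_of_nonneg_left h1 (by norm_num)
  have hS1b : (0.1038 + 0.2573) / (t + 1) ≤ 0.001 := by
    rw [div_le_iff₀ (by linarith)]; linarith
  have hS2a : 1 / (2 * π) * Real.log (t / (2 * π)) ≤ 0.15916 * L := by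
    have h0 : 0 ≤ Real.log (t / (2 * π)) := Real.log_nonneg (by rw [le_div_iff₀ (by positivity)]; linarith)
    calc _ ≤ 0.15916 * Real.log (t / (2 * π)) := mul_le_mul_of_nonneg_right hinv2π h0
      _ ≤ _ := mul_le_mul_of_nonneg_left hlogt2π (by norm_num)
  have hS4a : 1 / π * Real.log ((t + 1) / (2 * π)) ≤ 0.3184 * (L + 0.001) := by
    have h0 : 0 ≤ Real.log ((t + 1) / (2 * π)) := Real.log_nonneg (by rw [le_div_iff₀ (by positivity)]; linarith)
    calc _ ≤ 0.3184 * Real.log ((t + 1) / (2 * π)) := mul_le_mul_of_nonneg_right hinvπ h0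
      _ ≤ _ := mul_le_mul_of_nonneg_left hlog2π (by norm_num)
  -- assemble
  have hN := fordN_nonneg t (1 / 2)
  rw [hsplit]
  linarith [hS1, hS2, hS3, hS4, hWin, hq1, hqm1, hS1a, hS1b, hS2a, hS3', hS4a, hlog1, hloglog1,
    hL, hLL]

end FordFarZeros

/-- **(6.4) = Ford (9.2) for `t ≥ e²⁴⁰` from (3.8)**, for the far sum over `|1 + it − ρ| > ½`
(every finite partial sum). [cite: MossinghoffTrudgianYangRNT2024, (6.4)] [cite: Ford2002Millennium, (9.2)] -/
theorem farZeroSum_half_strict_of_hsw (h : zetaZeroCount_hasanalizade_shen_wong) :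
    ∀ t : ℝ, Real.exp 240 ≤ t → ∀ T : Finset ℂ,
      (∀ ρ ∈ T, riemannZeta ρ = 0 ∧ 0 < ρ.re ∧ ρ.re < 1 ∧ 1 / 2 < ‖1 + t * I - ρ‖) →
      ∑ ρ ∈ T, (riemannZetaZeroOrder ρ : ℝ) / ‖1 + t * I - ρ‖ ^ 2 ≤
        3.2357 * Real.log t + 5.316 * Real.log (Real.log t) + 16.134 - 4 * fordN t (1 / 2) :=
  fun _ ht T hT ↦ FordFarZeros.farZeroSum_half_of_hsw h ht T hT

/-- The same from the threshold `e⁹⁹⁹` (the shape of hypothesis `h92`, with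
`Far := FordFarZeroSumLT`, of `zero_free_region_intermediate_mossinghoff_trudgian_yang_of_ford` in
`VinogradovKorobovIntermediateAssembly.lean`). [cite: MossinghoffTrudgianYangRNT2024, (6.4)] -/
theorem farZeroSum_half_strict_of_hsw_exp999 (h : zetaZeroCount_hasanalizade_shen_wong) :
    ∀ t : ℝ, Real.exp 999 ≤ t → ∀ T : Finset ℂ,
      (∀ ρ ∈ T, riemannZeta ρ = 0 ∧ 0 < ρ.re ∧ ρ.re < 1 ∧ 1 / 2 < ‖1 + t * I - ρ‖) →
      ∑ ρ ∈ T, (riemannZetaZeroOrder ρ : ℝ) / ‖1 + t * I - ρ‖ ^ 2 ≤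
        3.2357 * Real.log t + 5.316 * Real.log (Real.log t) + 16.134 - 4 * fordN t (1 / 2) :=
  fun t ht T hT ↦ FordFarZeros.farZeroSum_half_of_hsw h
    ((Real.exp_le_exp.2 (by norm_num)).trans ht) T hT

end Literature.NumberTheory.LFunctions
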